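import Literature.NumberTheory.EllipticCurves.SelmerCorankControlProofs
import Literature.NumberTheory.EllipticCurves.KatoRankBoundProofs
import Literature.NumberTheory.EllipticCurves.KatoRankBoundSelmerProofs
import Literature.NumberTheory.EllipticCurves.IwasawaAlgebraPseudoNullProofs
import Mathlib.RingTheory.Ideal.AssociatedPrime.Finiteness
import HarnessLib

/-!
# The `Γ`-Euler characteristic of a finitely generated torsion `Λ`-module at `T = 0` (proofs)

Generic commutative algebra over the Iwasawa algebra `Λ = ℤ_p⟦T⟧ = IwasawaAlgebra p`
(theorems and honest definitions only; no named fact is introduced). For a `Λ`-module `M` write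
`M^Γ = M[T]` (`invariants`, the kernel of multiplication by `T`), `M_Γ = M/TM` (`coinvariants`)
and `φ_M : M[T] → M/TM` for the natural map (`bockstein`; Coates–Schneider–Sujatha (30):
"`φ_D(x) =` residue class of `x` in `D_Γ`"). For `M` finitely generated and `Λ`-torsion with
characteristic ideal `(f)` the two halves of the "generalised (truncated) `Γ`-Euler
characteristic" formalism are PROVED:

* `order_charGenerator_eq_coinvariantsRank_iff_finite_bockstein` :
  **`ord_{T=0} f = rank_{ℤ_p} M/TM` iff `ker φ_M` and `coker φ_M` are finite** (and
  `finite_ker_bockstein_iff_finite_coker_bockstein`: either finiteness implies the other); in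
  general `rank_{ℤ_p} M/TM ≤ ord_T f` (tree: `coinvariantsRank_le_order_of_mem_charIdeal`);
* `coeff_order_charGenerator_mul_card_ker_bockstein` : in that case **the leading coefficient
  `coeff_{ord_T f}(f)` satisfies `coeff_{ord_T f}(f) · #ker φ_M = u · #coker φ_M`, `u ∈ ℤ_pˣ`**,
  i.e. it has the `p`-adic valuation of the truncated Euler characteristic `#coker φ_M / #ker φ_M`.

Printed sources. For a discrete `p`-primary `Γ`-module `D` with Pontryagin dual `M`,
`φ_D : D^Γ → D_Γ` is dual to `φ_M`, `D` "has finite `Γ`-Euler characteristic" iff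
`q(φ_D) = #ker φ_D/#coker φ_D` is finite (Coates–Schneider–Sujatha, Doc. Math. Extra Vol. Kato
(2003), §3 (30)–(31)), and then `χ_t(Γ, D) = q(φ_D) = #coker φ_M/#ker φ_M` is `|g(0)|_p^{-1}`
for `f = T^{ord f} g` (Ray–Sujatha, Canad. Math. Bull. (2020), Lemma 2.4, after Zerbes, Proc. LMS
98 (2009); the case `ord_T f = 0` is Greenberg, LNM 1716, §4, Thm. 4.1 with Lemma 4.2:
`f(0) ∼ #H¹/#H⁰`). In structure-theorem terms `M ∼ ⊕ Λ/(T^{a_i}) ⊕ ⊕ Λ/(g_j)`, `T ∤ g_j`: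
`ord_T f = ∑ a_i ≥ #{i} = rank M/TM` with equality iff all `a_i = 1` (Greenberg, §1 p. 65, after
Conj. 1.12; Washington §13.2), and then `coeff_{ord f} f ∼ ∏ g_j(0) ∼ #⊕ Λ/(g_j, T)`.

Proofs. Everything goes through Bourbaki's local lengths `ℓ_𝔮 = Module.lengthAt` at
height-one primes (as in the tree's `Greenberg1999_order_charGenerator_eq_coinvariantsRank_holds`),
never through a chosen pseudo-isomorphism:
* criterion: `ord_T f = ℓ_𝔭(M)` (`𝔭 = (T)`), `rank M/TM = ℓ_𝔭(M/TM)`,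
  `ℓ_𝔭(M) = ℓ_𝔭(TM) + ℓ_𝔭(M/TM)`, `ℓ_𝔭(ker φ_M) = ℓ_𝔭(coker φ_M)`,
  `ℓ_𝔭(TM) = 0 ↔ ℓ_𝔭(ker φ_M) = 0`, and for `P` killed by `T`, `ℓ_𝔭(P) = rank_{ℤ_p} P = 0 ↔ P`
  finite;
* leading coefficient: `char(M) = ∏_{𝔮 ∈ S} 𝔮^{ℓ_𝔮(M)}` is an honest finite product of principal
  primes (`primeGen`, `Λ` is factorial), so `f = u · T^{ℓ_𝔭(M)} · ∏_{𝔮 ≠ 𝔭} q_𝔮^{ℓ_𝔮(M)}` and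
  `coeff_{ℓ_𝔭} f = u(0) ∏ q_𝔮(0)^{ℓ_𝔮} = U · p^{e(M)}`, `e(M) = ∑_{𝔮 ≠ 𝔭} ℓ_𝔮(M) v_p(q_𝔮(0))`
  (`eulerExp`); on the other side `ker φ_M ≃ N[T]`, `coker φ_M ≃ N/TN` for `N = TM`, which has
  `ℓ_𝔭(N) = 0` and `e(N) = e(M)`, and **`#(N/TN) = #N[T] · p^{e(N)}`**
  (`card_coinvariants_of_lengthAt_eq_zero`) is proved by dévissage over a prime filtration of `N`
  (Mathlib's `IsNoetherianRing.induction_on_isQuotientEquivQuotientPrime`): the Herbrand quotient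
  `#(·/T·)/#(·[T])` is multiplicative in short exact sequences by the snake lemma (Mathlib's
  `SnakeLemma.δ'`, `card_of_exact_six`), `e` is additive, and for the cyclic modules:
  `Λ/𝔪` is finite (both sides `1`), `Λ/(T)` is excluded by `ℓ_𝔭 = 0`, `Λ/(0)` by torsion, and for
  a height-one `𝔮 = (q) ≠ (T)`: `(Λ/𝔮)[T] = 0`, `#Λ/(q, T) = #ℤ_p/(q(0)) = p^{v_p(q(0))}`.

## References

* J. Coates, P. Schneider, R. Sujatha, *Links between cyclotomic and `GL₂` Iwasawa theory*,
  Doc. Math. Extra Vol. Kato (2003) 187–215, §3 (30)–(31), p. 204. [CoatesSchneiderSujatha2003]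
* A. Ray, R. Sujatha, *Euler characteristics and their congruences in the positive rank setting*,
  Canad. Math. Bull. 64 (2021) = arXiv:1910.03819, §2 (Def. of `χ_t`, Prop. 2.3, Lemma 2.4).
* R. Greenberg, *Iwasawa theory for elliptic curves*, LNM 1716 (1999), §1 p. 65, §4 Thm. 4.1.
  [GreenbergLNM1716]
* L. C. Washington, *Introduction to Cyclotomic Fields*, §13.2. [Washington1997]
* N. Bourbaki, *Algèbre commutative*, VII §4.4–4.5.
-/

noncomputable section

open scoped TensorProduct nonZeroDivisors

universe u

namespace Literature.NumberTheory.EllipticCurves.IwasawaAlgebra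

variable (p : ℕ) [Fact p.Prime]

/-! ### `M[T]`, `TM` and the map `φ_M : M[T] → M/TM` -/

section Defs

variable (M : Type u) [AddCommGroup M] [Module (IwasawaAlgebra p) M]

/-- The **`Γ`-invariants** `M^Γ = M[T] = {m : T m = 0}` of a `Λ = ℤ_p⟦T⟧`-module (`T = γ - 1`),
Mathlib's `Submodule.torsionBy`. For `M = X(E/K_∞)` this is the Pontryagin dual of the
`Γ`-coinvariants of `Sel_{p^∞}(E/K_∞)`. Greenberg (1999), §1; CSS (2003), §3. [folklore] -/
abbrev invariants : Submodule (IwasawaAlgebra p) M :=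
  Submodule.torsionBy (IwasawaAlgebra p) M (PowerSeries.X : IwasawaAlgebra p)

/-- The submodule `TM` (so that `coinvariants p M = M ⧸ TSubmodule p M`). [folklore] -/
abbrev TSubmodule : Submodule (IwasawaAlgebra p) M :=
  Ideal.span {(PowerSeries.X : IwasawaAlgebra p)} • (⊤ : Submodule (IwasawaAlgebra p) M)

/-- **The natural map `φ_M : M^Γ = M[T] → M_Γ = M/TM`**, `x ↦ x mod TM` (for the Pontryagin dual
`M` of a discrete `Γ`-module `D` this is the dual of CSS's `φ_D : D^Γ → D_Γ`, (30)). Its kernel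
and cokernel measure the failure of `T`-semisimplicity of `M`; their orders give the truncated
`Γ`-Euler characteristic. [cite: CoatesSchneiderSujatha2003, §3 (30)] -/
def bockstein : invariants p M →ₗ[IwasawaAlgebra p] coinvariants p M :=
  (TSubmodule p M).mkQ ∘ₗ (invariants p M).subtype

/-- Unfolding of `φ_M`: `φ_M(x) = x mod TM`. [folklore] -/
theorem bockstein_apply (x : invariants p M) :
    bockstein p M x = Submodule.Quotient.mk (x : M) := rfl

/-- `m ∈ M[T] ↔ T m = 0`. [folklore] -/
theorem mem_invariants_iff (m : M) :
    m ∈ invariants p M ↔ (PowerSeries.X : IwasawaAlgebra p) • m = 0 :=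
  Submodule.mem_torsionBy_iff _ _

/-- `T m ∈ TM`. [folklore] -/
theorem X_smul_mem_TSubmodule (m : M) :
    (PowerSeries.X : IwasawaAlgebra p) • m ∈ TSubmodule p M :=
  Submodule.smul_mem_smul (Ideal.subset_span rfl) Submodule.mem_top

/-- `m ∈ TM ↔ m = T y` for some `y`. [folklore] -/
theorem mem_TSubmodule_iff (m : M) :
    m ∈ TSubmodule p M ↔ ∃ y : M, (PowerSeries.X : IwasawaAlgebra p) • y = m := by
  rw [TSubmodule, Submodule.ideal_span_singleton_smul, Submodule.mem_smul_pointwise_iff_exists]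
  constructor
  · rintro ⟨y, -, rfl⟩
    exact ⟨y, rfl⟩
  · rintro ⟨y, rfl⟩
    exact ⟨y, Submodule.mem_top, rfl⟩

/-- `x ∈ ker φ_M ↔ x ∈ TM`, i.e. `ker φ_M = M[T] ∩ TM`. [folklore] -/
theorem mem_ker_bockstein_iff (x : invariants p M) :
    x ∈ LinearMap.ker (bockstein p M) ↔ (x : M) ∈ TSubmodule p M := by
  rw [LinearMap.mem_ker, bockstein_apply, Submodule.Quotient.mk_eq_zero]

/-- `T` kills `M[T]`. [folklore] -/
theorem X_smul_invariants (x : invariants p M) : (PowerSeries.X : IwasawaAlgebra p) • x = 0 :=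
  Subtype.ext x.2

/-- Multiplication by `T` as a `Λ`-linear map `M → TM` (onto, kernel `M[T]`). [folklore] -/
def mulXOnto : M →ₗ[IwasawaAlgebra p] TSubmodule p M :=
  (DistribSMul.toLinearMap (IwasawaAlgebra p) M (PowerSeries.X : IwasawaAlgebra p)).codRestrict
    (TSubmodule p M) (X_smul_mem_TSubmodule p M)

/-- Unfolding of `mulXOnto`. [folklore] -/
theorem mulXOnto_apply (m : M) :
    (mulXOnto p M m : M) = (PowerSeries.X : IwasawaAlgebra p) • m := rfl

/-- `m ↦ T m` maps `M` onto `TM`. [folklore] -/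
theorem mulXOnto_surjective : Function.Surjective (mulXOnto p M) := by
  rintro ⟨y, hy⟩
  obtain ⟨m, rfl⟩ := (mem_TSubmodule_iff p M y).mp hy
  exact ⟨m, rfl⟩

/-- The kernel of `m ↦ T m` is `M[T]`. [folklore] -/
theorem ker_mulXOnto : LinearMap.ker (mulXOnto p M) = invariants p M := by
  ext m
  rw [LinearMap.mem_ker, mem_invariants_iff, ← mulXOnto_apply]
  constructor
  · intro h
    rw [h, Submodule.coe_zero]
  · intro h
    exact Subtype.ext h

/-- Exactness of `0 → M[T] → M → TM`. [folklore] -/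
theorem exact_subtype_mulXOnto :
    Function.Exact (invariants p M).subtype (mulXOnto p M) := by
  intro m
  rw [← LinearMap.mem_ker, ker_mulXOnto]
  constructor
  · intro hm
    exact ⟨⟨m, hm⟩, rfl⟩
  · rintro ⟨x, rfl⟩
    exact x.2

end Defs

/-! ### Local lengths at `𝔭 = (T)` -/

section Lengths

variable (M : Type u) [AddCommGroup M] [Module (IwasawaAlgebra p) M]

/-- `ℓ_𝔭(M) = ℓ_𝔭(M[T]) + ℓ_𝔭(TM)` from `0 → M[T] → M → TM → 0`. [folklore] -/
theorem lengthAt_eq_invariants_add_TSubmodule :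
    Module.lengthAt (IwasawaAlgebra p) M (primeT p) =
      Module.lengthAt (IwasawaAlgebra p) (invariants p M) (primeT p) +
        Module.lengthAt (IwasawaAlgebra p) (TSubmodule p M) (primeT p) :=
  Module.lengthAt_eq_add_of_exact _ _ (Submodule.subtype_injective _) (mulXOnto_surjective p M)
    (exact_subtype_mulXOnto p M) _

/-- `ℓ_𝔭(M) = ℓ_𝔭(TM) + ℓ_𝔭(M/TM)` from `0 → TM → M → M/TM → 0`. [folklore] -/
theorem lengthAt_eq_TSubmodule_add_coinvariants :
    Module.lengthAt (IwasawaAlgebra p) M (primeT p) =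
      Module.lengthAt (IwasawaAlgebra p) (TSubmodule p M) (primeT p) +
        Module.lengthAt (IwasawaAlgebra p) (coinvariants p M) (primeT p) :=
  Module.lengthAt_eq_add_of_exact _ _ (Submodule.subtype_injective _) (Submodule.mkQ_surjective _)
    (LinearMap.exact_subtype_mkQ (TSubmodule p M)) _

/-- `ℓ_𝔭(M[T]) = ℓ_𝔭(ker φ_M) + ℓ_𝔭(range φ_M)`. [folklore] -/
theorem lengthAt_invariants_eq_ker_add_range :
    Module.lengthAt (IwasawaAlgebra p) (invariants p M) (primeT p) =
      Module.lengthAt (IwasawaAlgebra p) (LinearMap.ker (bockstein p M)) (primeT p) +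
        Module.lengthAt (IwasawaAlgebra p) (LinearMap.range (bockstein p M)) (primeT p) :=
  Module.lengthAt_eq_add_of_exact _ _ (Submodule.subtype_injective _)
    (LinearMap.surjective_rangeRestrict _)
    (LinearMap.exact_iff.mpr (by rw [LinearMap.ker_rangeRestrict, Submodule.range_subtype])) _

/-- `ℓ_𝔭(M/TM) = ℓ_𝔭(range φ_M) + ℓ_𝔭(coker φ_M)`. [folklore] -/
theorem lengthAt_coinvariants_eq_range_add_coker :
    Module.lengthAt (IwasawaAlgebra p) (coinvariants p M) (primeT p) =
      Module.lengthAt (IwasawaAlgebra p) (LinearMap.range (bockstein p M)) (primeT p) +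
        Module.lengthAt (IwasawaAlgebra p)
          (coinvariants p M ⧸ LinearMap.range (bockstein p M)) (primeT p) :=
  Module.lengthAt_eq_add_of_exact _ _ (Submodule.subtype_injective _) (Submodule.mkQ_surjective _)
    (LinearMap.exact_subtype_mkQ _) _

variable [Module.Finite (IwasawaAlgebra p) M] (hM : Module.IsTorsion (IwasawaAlgebra p) M)
include hM

/-- For `M` finitely generated and torsion, `ℓ_𝔭(M[T]) = ℓ_𝔭(M/TM)` (both equal
`ℓ_𝔭(M) - ℓ_𝔭(TM)`, all lengths being finite). [folklore] -/
theorem lengthAt_invariants_eq_lengthAt_coinvariants :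
    Module.lengthAt (IwasawaAlgebra p) (invariants p M) (primeT p) =
      Module.lengthAt (IwasawaAlgebra p) (coinvariants p M) (primeT p) := by
  have hfin := lengthAt_primeT_ne_top M hM
  have h1 := lengthAt_eq_invariants_add_TSubmodule p M
  have h2 := lengthAt_eq_TSubmodule_add_coinvariants p M
  have hT : Module.lengthAt (IwasawaAlgebra p) (TSubmodule p M) (primeT p) ≠ ⊤ := by
    intro h
    rw [h, add_top] at h1
    exact hfin h1
  rw [h1, add_comm] at h2
  exact WithTop.add_left_cancel hT h2

/-- For `M` finitely generated and torsion, `ℓ_𝔭(ker φ_M) = ℓ_𝔭(coker φ_M)`. [folklore] -/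
theorem lengthAt_ker_bockstein_eq_lengthAt_coker :
    Module.lengthAt (IwasawaAlgebra p) (LinearMap.ker (bockstein p M)) (primeT p) =
      Module.lengthAt (IwasawaAlgebra p)
        (coinvariants p M ⧸ LinearMap.range (bockstein p M)) (primeT p) := by
  have h := lengthAt_invariants_eq_lengthAt_coinvariants p M hM
  rw [lengthAt_invariants_eq_ker_add_range p M, lengthAt_coinvariants_eq_range_add_coker p M] at h
  set a := Module.lengthAt (IwasawaAlgebra p) (LinearMap.ker (bockstein p M)) (primeT p)
  set r := Module.lengthAt (IwasawaAlgebra p) (LinearMap.range (bockstein p M)) (primeT p)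
  set c := Module.lengthAt (IwasawaAlgebra p)
    (coinvariants p M ⧸ LinearMap.range (bockstein p M)) (primeT p)
  have hR : r ≠ ⊤ := by
    refine ne_top_of_le_ne_top (lengthAt_primeT_ne_top M hM) ?_
    refine (length_localizedModule_primeT_le_of_injective p _ (Submodule.subtype_injective _)).trans ?_
    exact length_localizedModule_primeT_le_of_surjective p _ (Submodule.mkQ_surjective _)
  rw [add_comm a r] at h
  exact WithTop.add_left_cancel hR h

/-- **`ℓ_𝔭(TM) = 0 ↔ ℓ_𝔭(ker φ_M) = 0`** for `M` finitely generated torsion. (`→`: `ker φ_M =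
M[T] ∩ TM ↪ TM`. `←`: `M` is killed by `T^k c` with `c(0) ≠ 0`; if `(M[T] ∩ TM)_𝔭 = 0` then by
descending induction every `T m`, `m ∈ M`, is killed by an element outside `𝔭`, i.e.
`(TM)_𝔭 = 0`.) [folklore] -/
theorem lengthAt_TSubmodule_eq_zero_iff :
    Module.lengthAt (IwasawaAlgebra p) (TSubmodule p M) (primeT p) = 0 ↔
      Module.lengthAt (IwasawaAlgebra p) (LinearMap.ker (bockstein p M)) (primeT p) = 0 := by
  constructor
  · intro h
    refine nonpos_iff_eq_zero.mp ?_
    rw [← h]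
    -- `ker φ_M ↪ TM`
    let ι : LinearMap.ker (bockstein p M) →ₗ[IwasawaAlgebra p] TSubmodule p M :=
      { toFun := fun x ↦ ⟨((x : invariants p M) : M), (mem_ker_bockstein_iff p M _).mp x.2⟩
        map_add' := fun _ _ ↦ rfl
        map_smul' := fun _ _ ↦ rfl }
    refine length_localizedModule_primeT_le_of_injective p ι ?_
    intro x y hxy
    have hval := congrArg Subtype.val hxy
    exact Subtype.ext (Subtype.ext hval)
  · intro h
    rw [Module.lengthAt_eq_zero_iff, LocalizedModule.subsingleton_iff] at h ⊢
    -- `M` is killed by `a = T^k · c`, `c(0) ≠ 0`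
    obtain ⟨a, ha, ha0⟩ := Submodule.annihilator_top_inter_nonZeroDivisors hM
    have haM : ∀ x : M, a • x = 0 := fun x ↦ Submodule.mem_annihilator.mp ha x Submodule.mem_top
    have hc : PowerSeries.constantCoeff (PowerSeries.divXPowOrder a) ≠ 0 := by
      rw [Ne, PowerSeries.constantCoeff_divXPowOrder_eq_zero_iff]
      exact nonZeroDivisors.ne_zero ha0
    -- descending induction on the power of `T`
    have key : ∀ k : ℕ, ∀ m : M, (∃ s ∈ (primeT p).asIdeal.primeCompl,
        s • (PowerSeries.X : IwasawaAlgebra p) ^ k • (PowerSeries.X : IwasawaAlgebra p) • m = 0) →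
        ∃ s ∈ (primeT p).asIdeal.primeCompl, s • (PowerSeries.X : IwasawaAlgebra p) • m = 0 := by
      intro k
      induction k with
      | zero =>
        rintro m ⟨s, hs, hsm⟩
        exact ⟨s, hs, by rwa [pow_zero, one_smul] at hsm⟩
      | succ k ih =>
        rintro m ⟨s, hs, hsm⟩
        -- apply the induction hypothesis to `T m`
        have h' : ∃ s ∈ (primeT p).asIdeal.primeCompl,
            s • (PowerSeries.X : IwasawaAlgebra p) ^ k • (PowerSeries.X : IwasawaAlgebra p) •
              ((PowerSeries.X : IwasawaAlgebra p) • m) = 0 :=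
          ⟨s, hs, by rwa [pow_succ, mul_smul] at hsm⟩
        obtain ⟨s', hs', hs'm⟩ := ih _ h'
        -- `s' T m ∈ M[T] ∩ TM = ker φ_M`, which is killed by some `s'' ∉ 𝔭`
        have hmemT : s' • (PowerSeries.X : IwasawaAlgebra p) • m ∈ TSubmodule p M :=
          Submodule.smul_mem _ _ (X_smul_mem_TSubmodule p M m)
        have hmemI : s' • (PowerSeries.X : IwasawaAlgebra p) • m ∈ invariants p M := by
          rw [mem_invariants_iff, smul_comm, hs'm]
        let x : LinearMap.ker (bockstein p M) :=
          ⟨⟨_, hmemI⟩, (mem_ker_bockstein_iff p M _).mpr hmemT⟩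
        obtain ⟨s'', hs'', hx⟩ := h x
        refine ⟨s'' * s', (primeT p).asIdeal.primeCompl.mul_mem hs'' hs', ?_⟩
        rw [mul_smul]
        simpa [x] using congrArg (fun z : LinearMap.ker (bockstein p M) ↦ ((z : invariants p M) : M)) hx
    rintro ⟨y, hy⟩
    obtain ⟨m, rfl⟩ := (mem_TSubmodule_iff p M y).mp hy
    have hstart : ∃ s ∈ (primeT p).asIdeal.primeCompl,
        s • (PowerSeries.X : IwasawaAlgebra p) ^ a.order.toNat • (PowerSeries.X : IwasawaAlgebra p) •
          m = 0 := by
      refine ⟨PowerSeries.divXPowOrder a, ?_, ?_⟩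
      · rw [Ideal.mem_primeCompl_iff, primeT_asIdeal, mem_span_X_iff]
        exact hc
      · rw [smul_smul, mul_comm, PowerSeries.X_pow_order_mul_divXPowOrder]
        exact haM _
    obtain ⟨s, hs, hsm⟩ := key _ m hstart
    exact ⟨s, hs, Subtype.ext hsm⟩

end Lengths

/-! ### Modules killed by `T`: `ℓ_𝔭 = rank_{ℤ_p}`, and finiteness -/

section KilledByT

variable (P : Type u) [AddCommGroup P] [Module (IwasawaAlgebra p) P]

/-- A finitely generated `Λ`-module killed by `T` is finitely generated over `ℤ_p` (for the
restricted structure): a power series acts through its constant term. [folklore] -/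
theorem moduleFinite_int_of_X_smul_eq_zero [Module.Finite (IwasawaAlgebra p) P]
    [Module ℤ_[p] P] [IsScalarTower ℤ_[p] (IwasawaAlgebra p) P]
    (hT : ∀ x : P, (PowerSeries.X : IwasawaAlgebra p) • x = 0) : Module.Finite ℤ_[p] P := by
  classical
  obtain ⟨n, s, hs⟩ := Module.Finite.exists_fin (R := IwasawaAlgebra p) (M := P)
  refine ⟨⟨(Finset.univ.image s), ?_⟩⟩
  rw [Finset.coe_image, Finset.coe_univ, Set.image_univ, eq_top_iff]
  intro x _
  have hx : x ∈ Submodule.span (IwasawaAlgebra p) (Set.range s) := by rw [hs]; trivial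
  obtain ⟨c, rfl⟩ := (Submodule.mem_span_range_iff_exists_fun (IwasawaAlgebra p)).mp hx
  refine Submodule.sum_mem _ fun i _ ↦ ?_
  rw [smul_eq_C_smul_of_X_smul_eq_zero p (c i) (hT (s i)), ← PowerSeries.algebraMap_eq,
    algebraMap_smul]
  exact Submodule.smul_mem _ _ (Submodule.subset_span ⟨i, rfl⟩)

/-- **A finitely generated `Λ`-module `P` killed by `T` is finite iff `ℓ_𝔭(P) = 0`**
(`ℓ_𝔭(P) = rank_{ℤ_p} P`, and a finitely generated `ℤ_p`-module has rank `0` iff it is torsion iff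
it is finite). [folklore] -/
theorem finite_iff_lengthAt_eq_zero_of_X_smul_eq_zero [Module.Finite (IwasawaAlgebra p) P]
    (hT : ∀ x : P, (PowerSeries.X : IwasawaAlgebra p) • x = 0) :
    Finite P ↔ Module.lengthAt (IwasawaAlgebra p) P (primeT p) = 0 := by
  letI : Module ℤ_[p] P := Module.compHom _ (algebraMap ℤ_[p] (IwasawaAlgebra p))
  haveI : IsScalarTower ℤ_[p] (IwasawaAlgebra p) P := IsScalarTower.of_compHom ℤ_[p] _ _
  haveI : Module.Finite ℤ_[p] P := moduleFinite_int_of_X_smul_eq_zero p P hT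
  rw [lengthAt_eq_toENat_rank_of_X_smul_eq_zero p hT (primeT p) (primeT_asIdeal p),
    Cardinal.toENat_eq_zero, rank_eq_zero_iff_isTorsion]
  constructor
  · intro hfin x
    obtain ⟨n, hn, hnx⟩ := (isOfFinAddOrder_of_finite x).exists_nsmul_eq_zero
    refine ⟨⟨(n : ℤ_[p]), mem_nonZeroDivisors_of_ne_zero (by exact_mod_cast hn.ne')⟩, ?_⟩
    rw [Submonoid.smul_def, Nat.cast_smul_eq_nsmul]
    exact hnx
  · intro htors
    have htop : Submodule.torsion ℤ_[p] P = ⊤ := by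
      rw [eq_top_iff]
      intro x _
      exact htors (x := x)
    haveI := ZpCorank.finite_torsion p P
    have e : (Submodule.torsion ℤ_[p] P) ≃ P :=
      (LinearEquiv.ofTop _ htop).toEquiv
    exact Finite.of_equiv _ e

end KilledByT

/-! ### The criterion -/

section Criterion

variable (M : Type u) [AddCommGroup M] [Module (IwasawaAlgebra p) M]

/-- `rank_{ℤ_p} M/TM = ℓ_𝔭(M/TM)` (as natural numbers; both sides measured with the same junk
conventions: `finrank`/`toNat`). [folklore] -/
theorem toNat_lengthAt_coinvariants_eq_coinvariantsRank :
    (Module.lengthAt (IwasawaAlgebra p) (coinvariants p M) (primeT p)).toNat =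
      coinvariantsRank p M := by
  letI : Module ℤ_[p] (coinvariants p M) :=
    Module.compHom _ (algebraMap ℤ_[p] (IwasawaAlgebra p))
  haveI : IsScalarTower ℤ_[p] (IwasawaAlgebra p) (coinvariants p M) :=
    IsScalarTower.of_compHom ℤ_[p] _ _
  rw [lengthAt_eq_toENat_rank_of_X_smul_eq_zero p (X_smul_coinvariants p M) (primeT p)
      (primeT_asIdeal p), Cardinal.toNat_toENat, coinvariantsRank_eq_finrank_int]
  rfl

variable [Module.Finite (IwasawaAlgebra p) M] (hM : Module.IsTorsion (IwasawaAlgebra p) M)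
include hM

/-- **`ord_{T=0} f = rank_{ℤ_p} M/TM ↔ ℓ_𝔭(TM) = 0`** for `char(M) = (f)`. [folklore] -/
theorem order_charGenerator_eq_coinvariantsRank_iff_lengthAt (f : IwasawaAlgebra p)
    (hf : Module.charIdeal (IwasawaAlgebra p) M = Ideal.span {f}) :
    f.order = (coinvariantsRank p M : ℕ∞) ↔
      Module.lengthAt (IwasawaAlgebra p) (TSubmodule p M) (primeT p) = 0 := by
  have hfin := lengthAt_primeT_ne_top M hM
  have h2 := lengthAt_eq_TSubmodule_add_coinvariants p M
  have hC : Module.lengthAt (IwasawaAlgebra p) (coinvariants p M) (primeT p) ≠ ⊤ := by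
    intro h
    rw [h, add_top] at h2
    exact hfin h2
  rw [order_eq_toNat_lengthAt p hM f hf (primeT p) (primeT_asIdeal p),
    ← toNat_lengthAt_coinvariants_eq_coinvariantsRank p M, ENat.coe_toNat hfin, ENat.coe_toNat hC,
    h2]
  constructor
  · intro h
    by_contra hne
    have hpos : 0 < Module.lengthAt (IwasawaAlgebra p) (TSubmodule p M) (primeT p) :=
      pos_iff_ne_zero.mpr hne
    have : Module.lengthAt (IwasawaAlgebra p) (coinvariants p M) (primeT p) <
        Module.lengthAt (IwasawaAlgebra p) (TSubmodule p M) (primeT p) +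
          Module.lengthAt (IwasawaAlgebra p) (coinvariants p M) (primeT p) :=
      ENat.lt_add_left hC hpos
    exact this.ne' h
  · intro h
    rw [h, zero_add]

/-- **`ord_{T=0} f = rank_{ℤ_p} M/TM` iff `ker φ_M` is finite**, for a finitely generated torsion
`Λ`-module `M` with `char(M) = (f)` (the `Λ`-module half of "finite truncated `Γ`-Euler
characteristic": CSS (2003) §3; Greenberg (1999) §1 p. 65; Washington §13.2).
[cite: CoatesSchneiderSujatha2003, §3 (30)–(31)] [cite: GreenbergLNM1716, §1 p. 65] -/
theorem order_charGenerator_eq_coinvariantsRank_iff_finite_ker_bockstein (f : IwasawaAlgebra p)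
    (hf : Module.charIdeal (IwasawaAlgebra p) M = Ideal.span {f}) :
    f.order = (coinvariantsRank p M : ℕ∞) ↔ Finite (LinearMap.ker (bockstein p M)) := by
  rw [order_charGenerator_eq_coinvariantsRank_iff_lengthAt p M hM f hf,
    lengthAt_TSubmodule_eq_zero_iff p M hM,
    finite_iff_lengthAt_eq_zero_of_X_smul_eq_zero p (LinearMap.ker (bockstein p M))
      (fun x ↦ Subtype.ext (X_smul_invariants p M (x : invariants p M)))]

/-- **`ker φ_M` is finite iff `coker φ_M` is finite** (`M` finitely generated torsion):
`ℓ_𝔭(ker φ_M) = ℓ_𝔭(coker φ_M)` and both are killed by `T`. [folklore] -/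
theorem finite_ker_bockstein_iff_finite_coker_bockstein :
    Finite (LinearMap.ker (bockstein p M)) ↔
      Finite (coinvariants p M ⧸ LinearMap.range (bockstein p M)) := by
  rw [finite_iff_lengthAt_eq_zero_of_X_smul_eq_zero p (LinearMap.ker (bockstein p M))
      (fun x ↦ Subtype.ext (X_smul_invariants p M (x : invariants p M))),
    finite_iff_lengthAt_eq_zero_of_X_smul_eq_zero p
      (coinvariants p M ⧸ LinearMap.range (bockstein p M)) ?_,
    lengthAt_ker_bockstein_eq_lengthAt_coker p M hM]
  intro q
  induction q using Submodule.Quotient.induction_on with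
  | H x => rw [← Submodule.Quotient.mk_smul, X_smul_coinvariants p M x, Submodule.Quotient.mk_zero]

/-- Order-of-vanishing form: **`ord_{T=0} f = rank_{ℤ_p} M/TM` iff `ker φ_M` and `coker φ_M` are
finite.** [cite: CoatesSchneiderSujatha2003, §3 (30)–(31)] [cite: GreenbergLNM1716, §1 p. 65] -/
theorem order_charGenerator_eq_coinvariantsRank_iff_finite_bockstein (f : IwasawaAlgebra p)
    (hf : Module.charIdeal (IwasawaAlgebra p) M = Ideal.span {f}) :
    f.order = (coinvariantsRank p M : ℕ∞) ↔
      (Finite (LinearMap.ker (bockstein p M)) ∧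
        Finite (coinvariants p M ⧸ LinearMap.range (bockstein p M))) := by
  rw [order_charGenerator_eq_coinvariantsRank_iff_finite_ker_bockstein p M hM f hf,
    ← finite_ker_bockstein_iff_finite_coker_bockstein p M hM, and_self_iff]

end Criterion

/-! ### Generators of the height-one primes of `Λ` and the factorisation of `f` -/

section Gen

open scoped Classical in
/-- A generator of a height-one prime `𝔮` of the factorial ring `Λ` (`𝔮 = (primeGen 𝔮)`,
`span_primeGen`); junk value `0` if `𝔮` is not principal. Washington §13.2 (`Λ` is a UFD, its
height-one primes are `(p)` and `(f)`, `f` irreducible distinguished). [folklore] -/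
def primeGen (𝔮 : PrimeSpectrum (IwasawaAlgebra p)) : IwasawaAlgebra p :=
  if h : ∃ q : IwasawaAlgebra p, 𝔮.asIdeal = Ideal.span {q} then h.choose else 0

variable {p}

/-- The zero ideal does not have height one. [folklore] -/
theorem height_ne_one_of_eq_bot {𝔮 : PrimeSpectrum (IwasawaAlgebra p)} (h : 𝔮.asIdeal = ⊥) :
    𝔮.asIdeal.height ≠ 1 := by
  rw [Ideal.height_eq_zero_iff_eq_bot.mpr h]
  exact zero_ne_one

/-- A height-one prime of `Λ` is generated by `primeGen`. [folklore] -/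
theorem span_primeGen {𝔮 : PrimeSpectrum (IwasawaAlgebra p)} (h𝔮 : 𝔮.asIdeal.height = 1) :
    Ideal.span {primeGen p 𝔮} = 𝔮.asIdeal := by
  have hex : ∃ q : IwasawaAlgebra p, 𝔮.asIdeal = Ideal.span {q} := by
    have hne : 𝔮.asIdeal ≠ ⊥ := fun h ↦ height_ne_one_of_eq_bot h h𝔮
    obtain ⟨π, hπmem, hπ⟩ := 𝔮.isPrime.exists_mem_prime_of_ne_bot hne
    exact ⟨π, Ideal.eq_span_singleton_of_height_eq_one h𝔮 hπmem hπ⟩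
  classical
  rw [primeGen, dif_pos hex]
  exact hex.choose_spec.symm

/-- `primeGen 𝔮 ∈ 𝔮`. [folklore] -/
theorem primeGen_mem {𝔮 : PrimeSpectrum (IwasawaAlgebra p)} (h𝔮 : 𝔮.asIdeal.height = 1) :
    primeGen p 𝔮 ∈ 𝔮.asIdeal := by
  rw [← span_primeGen h𝔮]
  exact Ideal.mem_span_singleton_self _

/-- `primeGen 𝔮 ≠ 0` for a height-one prime. [folklore] -/
theorem primeGen_ne_zero {𝔮 : PrimeSpectrum (IwasawaAlgebra p)} (h𝔮 : 𝔮.asIdeal.height = 1) :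
    primeGen p 𝔮 ≠ 0 := by
  intro h0
  have h := span_primeGen h𝔮
  rw [h0, Ideal.span_singleton_zero] at h
  exact height_ne_one_of_eq_bot h.symm h𝔮

/-- `primeGen 𝔮` is a prime element for a height-one prime `𝔮`. [folklore] -/
theorem prime_primeGen {𝔮 : PrimeSpectrum (IwasawaAlgebra p)} (h𝔮 : 𝔮.asIdeal.height = 1) :
    Prime (primeGen p 𝔮) := by
  rw [← Ideal.span_singleton_prime (primeGen_ne_zero h𝔮), span_primeGen h𝔮]
  exact 𝔮.isPrime

/-- Two height-one primes of `Λ` in containment are equal. [folklore] -/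
theorem eq_of_height_eq_one_of_le {𝔮 𝔮' : PrimeSpectrum (IwasawaAlgebra p)}
    (h𝔮 : 𝔮.asIdeal.height = 1) (h𝔮' : 𝔮'.asIdeal.height = 1) (hle : 𝔮.asIdeal ≤ 𝔮'.asIdeal) :
    𝔮 = 𝔮' := by
  apply PrimeSpectrum.ext
  rw [← span_primeGen h𝔮]
  exact (Ideal.eq_span_singleton_of_height_eq_one h𝔮' (hle (primeGen_mem h𝔮))
    (prime_primeGen h𝔮)).symm

/-- For a height-one prime `𝔮 ≠ (T)`, the generator has nonzero constant term (`T ∤ primeGen 𝔮`).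
[folklore] -/
theorem constantCoeff_primeGen_ne_zero {𝔮 : PrimeSpectrum (IwasawaAlgebra p)}
    (h𝔮 : 𝔮.asIdeal.height = 1) (hne : 𝔮 ≠ primeT p) :
    PowerSeries.constantCoeff (primeGen p 𝔮) ≠ 0 := by
  intro h0
  apply hne
  refine eq_of_height_eq_one_of_le h𝔮 (height_primeT p) ?_
  rw [← span_primeGen h𝔮, Ideal.span_singleton_le_iff_mem, primeT_asIdeal, mem_span_X_iff]
  exact h0

/-- `T ∉ 𝔮` for a height-one prime `𝔮 ≠ (T)`. [folklore] -/
theorem X_notMem_of_ne_primeT {𝔮 : PrimeSpectrum (IwasawaAlgebra p)}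
    (h𝔮 : 𝔮.asIdeal.height = 1) (hne : 𝔮 ≠ primeT p) :
    (PowerSeries.X : IwasawaAlgebra p) ∉ 𝔮.asIdeal := by
  intro hX
  apply hne
  refine (eq_of_height_eq_one_of_le (height_primeT p) h𝔮 ?_).symm
  rw [primeT_asIdeal, Ideal.span_singleton_le_iff_mem]
  exact hX

/-- The generator of `(T)` is an associate of `T`. [folklore] -/
theorem associated_primeGen_primeT :
    Associated (primeGen p (primeT p)) (PowerSeries.X : IwasawaAlgebra p) := by
  rw [← Ideal.span_singleton_eq_span_singleton, span_primeGen (height_primeT p), primeT_asIdeal]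

variable (p)

/-- **The characteristic ideal as an honest finite product.** For a finitely generated torsion
`Λ`-module `M` there is a finite set `S` of height-one primes, containing every height-one prime at
which `M` has nonzero local length, with `char(M) = ∏_{𝔮 ∈ S} 𝔮^{ℓ_𝔮(M)}`.
(Bourbaki AC VII §4.5; Washington §13.2.) [folklore] -/
theorem charIdeal_eq_finsetProd (M : Type u) [AddCommGroup M] [Module (IwasawaAlgebra p) M]
    [Module.Finite (IwasawaAlgebra p) M] (hM : Module.IsTorsion (IwasawaAlgebra p) M) :
    ∃ S : Finset (PrimeSpectrum (IwasawaAlgebra p)),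
      (∀ 𝔮 ∈ S, 𝔮.asIdeal.height = 1) ∧
      (∀ 𝔮 : PrimeSpectrum (IwasawaAlgebra p), 𝔮.asIdeal.height = 1 → 𝔮 ∉ S →
        Module.lengthAt (IwasawaAlgebra p) M 𝔮 = 0) ∧
      Module.charIdeal (IwasawaAlgebra p) M =
        ∏ 𝔮 ∈ S, 𝔮.asIdeal ^ (Module.lengthAt (IwasawaAlgebra p) M 𝔮).toNat := by
  obtain ⟨s, hs, hs0⟩ := Submodule.annihilator_top_inter_nonZeroDivisors hM
  have hsM : Module.IsTorsionBy (IwasawaAlgebra p) M s := fun x ↦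
    Submodule.mem_annihilator.mp hs x Submodule.mem_top
  have hfin := Module.finite_heightOne_inter_mulSupport (nonZeroDivisors.ne_zero hs0) hsM
  refine ⟨hfin.toFinset, ?_, ?_, ?_⟩
  · intro 𝔮 h𝔮
    exact ((Set.Finite.mem_toFinset hfin).mp h𝔮).1
  · intro 𝔮 h𝔮 hnot
    rw [Set.Finite.mem_toFinset, Set.mem_inter_iff, not_and, Function.mem_mulSupport, not_not] at hnot
    have h1 := hnot h𝔮
    have hne : Module.lengthAt (IwasawaAlgebra p) M 𝔮 ≠ ⊤ :=
      Module.lengthAt_ne_top_of_isTorsionBy (nonZeroDivisors.ne_zero hs0) hsM 𝔮 h𝔮.le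
    have hk : (Module.lengthAt (IwasawaAlgebra p) M 𝔮).toNat = 0 := by
      by_contra hk
      have hle := Ideal.pow_le_self (I := 𝔮.asIdeal) hk
      rw [h1, Ideal.one_eq_top, top_le_iff] at hle
      exact 𝔮.isPrime.ne_top hle
    rcases ENat.toNat_eq_zero.mp hk with h | h
    · exact h
    · exact absurd h hne
  · unfold Module.charIdeal
    exact finprod_mem_eq_prod _ hfin

/-- **Factorisation of a characteristic power series.** If `char(M) = (f)` for a finitely
generated torsion `Λ`-module `M`, then `f = u · T^{ℓ_{(T)}(M)} · ∏_{𝔮 ∈ S} q_𝔮^{ℓ_𝔮(M)}` for a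
unit `u`, where `S` is a finite set of height-one primes `𝔮 ≠ (T)` (generators `q_𝔮 = primeGen 𝔮`,
`q_𝔮(0) ≠ 0`) outside of which (and of `(T)`) all local lengths of `M` vanish.
(Washington §13.2: `f = p^μ ∏ f_j^{m_j}` up to a unit.) [cite: Washington1997, §13.2] -/
theorem exists_charGenerator_eq_unit_mul (M : Type u) [AddCommGroup M]
    [Module (IwasawaAlgebra p) M] [Module.Finite (IwasawaAlgebra p) M]
    (hM : Module.IsTorsion (IwasawaAlgebra p) M) (f : IwasawaAlgebra p)
    (hf : Module.charIdeal (IwasawaAlgebra p) M = Ideal.span {f}) :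
    ∃ (S : Finset (PrimeSpectrum (IwasawaAlgebra p))) (u : (IwasawaAlgebra p)ˣ),
      (∀ 𝔮 ∈ S, 𝔮.asIdeal.height = 1 ∧ 𝔮 ≠ primeT p) ∧
      (∀ 𝔮 : PrimeSpectrum (IwasawaAlgebra p), 𝔮.asIdeal.height = 1 → 𝔮 ≠ primeT p → 𝔮 ∉ S →
        Module.lengthAt (IwasawaAlgebra p) M 𝔮 = 0) ∧
      f = u * (PowerSeries.X : IwasawaAlgebra p) ^
          (Module.lengthAt (IwasawaAlgebra p) M (primeT p)).toNat *
        ∏ 𝔮 ∈ S, primeGen p 𝔮 ^ (Module.lengthAt (IwasawaAlgebra p) M 𝔮).toNat := by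
  classical
  obtain ⟨S₀, hS₀, hout, hchar⟩ := charIdeal_eq_finsetProd p M hM
  -- rewrite the product of prime powers as a principal ideal
  have hprod : ∏ 𝔮 ∈ S₀, 𝔮.asIdeal ^ (Module.lengthAt (IwasawaAlgebra p) M 𝔮).toNat =
      Ideal.span {∏ 𝔮 ∈ S₀, primeGen p 𝔮 ^ (Module.lengthAt (IwasawaAlgebra p) M 𝔮).toNat} := by
    rw [← Ideal.prod_span_singleton]
    refine Finset.prod_congr rfl fun 𝔮 h𝔮 ↦ ?_
    rw [← Ideal.span_singleton_pow, span_primeGen (hS₀ 𝔮 h𝔮)]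
  -- split off the factor at `𝔭 = (T)`
  set n : ℕ := (Module.lengthAt (IwasawaAlgebra p) M (primeT p)).toNat with hn
  set S := S₀.erase (primeT p) with hS
  set j : IwasawaAlgebra p :=
    ∏ 𝔮 ∈ S, primeGen p 𝔮 ^ (Module.lengthAt (IwasawaAlgebra p) M 𝔮).toNat with hj
  obtain ⟨v, hv⟩ := associated_primeGen_primeT (p := p)
  -- `∏_{S₀} = (gen 𝔭)^n · j` in both cases `𝔭 ∈ S₀`, `𝔭 ∉ S₀`
  have hsplit : ∏ 𝔮 ∈ S₀, primeGen p 𝔮 ^ (Module.lengthAt (IwasawaAlgebra p) M 𝔮).toNat =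
      primeGen p (primeT p) ^ n * j := by
    by_cases hmem : primeT p ∈ S₀
    · rw [hj, hS, ← Finset.mul_prod_erase S₀ _ hmem]
    · have hn0 : n = 0 := by
        rw [hn, hout (primeT p) (height_primeT p) hmem, ENat.toNat_zero]
      rw [hn0, pow_zero, one_mul, hj, hS, Finset.erase_eq_of_notMem hmem]
  have hassoc : Associated f (primeGen p (primeT p) ^ n * j) := by
    rw [← Ideal.span_singleton_eq_span_singleton, ← hf, hchar, hprod, hsplit]
  obtain ⟨w, hw⟩ := hassoc.symm
  refine ⟨S, w * (v⁻¹) ^ n, ?_, ?_, ?_⟩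
  · intro 𝔮 h𝔮
    rw [hS, Finset.mem_erase] at h𝔮
    exact ⟨hS₀ 𝔮 h𝔮.2, h𝔮.1⟩
  · intro 𝔮 h𝔮 hne hnot
    refine hout 𝔮 h𝔮 ?_
    rw [hS, Finset.mem_erase, not_and] at hnot
    exact fun h ↦ hnot hne h
  · rw [← hw]
    have hX : primeGen p (primeT p) = (PowerSeries.X : IwasawaAlgebra p) * (v⁻¹ : (IwasawaAlgebra p)ˣ) := by
      rw [← hv, mul_assoc, Units.mul_inv, mul_one]
    rw [hX, mul_pow, Units.val_mul, Units.val_pow_eq_pow_val]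
    ring

/-- The coefficient of `T^n` in `u · T^n · j` is `u(0) · j(0)`. [folklore] -/
theorem coeff_unit_mul_X_pow_mul (u j : IwasawaAlgebra p) (n : ℕ) :
    PowerSeries.coeff n (u * (PowerSeries.X : IwasawaAlgebra p) ^ n * j) =
      PowerSeries.constantCoeff u * PowerSeries.constantCoeff j := by
  rw [show u * (PowerSeries.X : IwasawaAlgebra p) ^ n * j = PowerSeries.X ^ n * (u * j) by ring,
    PowerSeries.coeff_X_pow_mul', if_pos le_rfl, Nat.sub_self,
    PowerSeries.coeff_zero_eq_constantCoeff_apply, map_mul]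

end Gen

/-! ### The `Γ`-Euler characteristic exponent `e(N) = ∑_{𝔮 ≠ (T)} ℓ_𝔮(N) · v_p(q_𝔮(0))` -/

section EulerExp

/-- `v_p(q_𝔮(0))` for the generator `q_𝔮` of a height-one prime `𝔮 ≠ (T)` (for `𝔮 = (q)`,
`#Λ/(q, T) = #ℤ_p/(q(0)) = p^{v_p(q(0))}`). [folklore] -/
def constVal (𝔮 : PrimeSpectrum (IwasawaAlgebra p)) : ℕ :=
  (PowerSeries.constantCoeff (primeGen p 𝔮)).valuation

/-- The set of height-one primes of `Λ` other than `𝔭 = (T)`. [folklore] -/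
def heightOneNeT : Set (PrimeSpectrum (IwasawaAlgebra p)) :=
  {𝔮 | 𝔮.asIdeal.height = 1 ∧ 𝔮 ≠ primeT p}

/-- **The `Γ`-Euler characteristic exponent** of a `Λ`-module `N`:
`e(N) = ∑_{ht 𝔮 = 1, 𝔮 ≠ (T)} ℓ_𝔮(N) · v_p(q_𝔮(0))` (a finite sum for `N` finitely generated
torsion). If `char(N) = (g)` with `T ∤ g` then `e(N) = v_p(g(0))`; in general `p^{e(N)}` is, up to
a unit, the leading coefficient of a characteristic power series of `N`. [folklore] -/
def eulerExp (N : Type u) [AddCommGroup N] [Module (IwasawaAlgebra p) N] : ℕ :=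
  ∑ᶠ 𝔮 ∈ heightOneNeT p, (Module.lengthAt (IwasawaAlgebra p) N 𝔮).toNat * constVal p 𝔮

variable {p}

/-- Unfolding of `heightOneNeT`. [folklore] -/
theorem mem_heightOneNeT {𝔮 : PrimeSpectrum (IwasawaAlgebra p)} :
    𝔮 ∈ heightOneNeT p ↔ 𝔮.asIdeal.height = 1 ∧ 𝔮 ≠ primeT p := Iff.rfl

section Torsion

variable {N₁ N₂ N₃ : Type u} [AddCommGroup N₁] [Module (IwasawaAlgebra p) N₁]
  [AddCommGroup N₂] [Module (IwasawaAlgebra p) N₂] [AddCommGroup N₃] [Module (IwasawaAlgebra p) N₃]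

/-- A submodule of a torsion module is torsion. [folklore] -/
theorem isTorsion_of_injective (f : N₁ →ₗ[IwasawaAlgebra p] N₂) (hf : Function.Injective f)
    (h : Module.IsTorsion (IwasawaAlgebra p) N₂) : Module.IsTorsion (IwasawaAlgebra p) N₁ := by
  intro x
  obtain ⟨a, ha⟩ := @h (f x)
  refine ⟨a, hf ?_⟩
  rw [Submonoid.smul_def, map_smul, map_zero]
  exact ha

/-- A quotient of a torsion module is torsion. [folklore] -/
theorem isTorsion_of_surjective (g : N₂ →ₗ[IwasawaAlgebra p] N₃) (hg : Function.Surjective g)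
    (h : Module.IsTorsion (IwasawaAlgebra p) N₂) : Module.IsTorsion (IwasawaAlgebra p) N₃ := by
  intro y
  obtain ⟨x, rfl⟩ := hg y
  obtain ⟨a, ha⟩ := @h x
  refine ⟨a, ?_⟩
  rw [Submonoid.smul_def, ← map_smul, ← Submonoid.smul_def, ha, map_zero]

end Torsion

/-- All local lengths of a finitely generated torsion `Λ`-module at primes of height `≤ 1` are
finite. [folklore] -/
theorem lengthAt_ne_top_of_isTorsion (N : Type u) [AddCommGroup N] [Module (IwasawaAlgebra p) N]
    [Module.Finite (IwasawaAlgebra p) N] (hN : Module.IsTorsion (IwasawaAlgebra p) N)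
    (𝔮 : PrimeSpectrum (IwasawaAlgebra p)) (h𝔮 : 𝔮.asIdeal.height ≤ 1) :
    Module.lengthAt (IwasawaAlgebra p) N 𝔮 ≠ ⊤ := by
  obtain ⟨s, hs, hs0⟩ := Submodule.annihilator_top_inter_nonZeroDivisors hN
  exact Module.lengthAt_ne_top_of_isTorsionBy (nonZeroDivisors.ne_zero hs0)
    (fun m ↦ Submodule.mem_annihilator.mp hs m Submodule.mem_top) 𝔮 h𝔮

/-- The summands of `e(N)` are supported on a finite set of primes (for `N` finitely generated
torsion). [folklore] -/
theorem finite_heightOneNeT_inter_support (N : Type u) [AddCommGroup N]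
    [Module (IwasawaAlgebra p) N] [Module.Finite (IwasawaAlgebra p) N]
    (hN : Module.IsTorsion (IwasawaAlgebra p) N) :
    (heightOneNeT p ∩ Function.support fun 𝔮 ↦
      (Module.lengthAt (IwasawaAlgebra p) N 𝔮).toNat * constVal p 𝔮).Finite := by
  obtain ⟨S, hS, hout, -⟩ := charIdeal_eq_finsetProd p N hN
  refine (S.finite_toSet).subset ?_
  rintro 𝔮 ⟨h𝔮, hsupp⟩
  by_contra hnot
  refine hsupp (show (Module.lengthAt (IwasawaAlgebra p) N 𝔮).toNat * constVal p 𝔮 = 0 from ?_)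
  rw [hout 𝔮 h𝔮.1 (fun h ↦ hnot (Finset.mem_coe.mpr h)), ENat.toNat_zero, zero_mul]

/-- `e(N) = 0` if all local lengths of `N` at height-one primes `≠ (T)` vanish. [folklore] -/
theorem eulerExp_eq_zero_of_forall (N : Type u) [AddCommGroup N] [Module (IwasawaAlgebra p) N]
    (h : ∀ 𝔮 ∈ heightOneNeT p, Module.lengthAt (IwasawaAlgebra p) N 𝔮 = 0) : eulerExp p N = 0 :=
  finsum_mem_eq_zero_of_forall_eq_zero fun 𝔮 h𝔮 ↦ by rw [h 𝔮 h𝔮, ENat.toNat_zero, zero_mul]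

/-- `e(N) = 0` for a finite `Λ`-module (finite = pseudo-null: all localisations at primes of
height `≤ 1` vanish). [folklore] -/
theorem eulerExp_eq_zero_of_finite (N : Type u) [AddCommGroup N] [Module (IwasawaAlgebra p) N]
    [Finite N] : eulerExp p N = 0 := by
  refine eulerExp_eq_zero_of_forall N fun 𝔮 h𝔮 ↦ ?_
  rw [Module.lengthAt_eq_zero_iff]
  exact isPseudoNull_of_finite p N 𝔮 (le_of_eq h𝔮.1)

/-- **Additivity of `e`** in short exact sequences `0 → N₁ → N₂ → N₃ → 0` with `N₂` finitely
generated torsion. [folklore] -/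
theorem eulerExp_eq_add_of_exact {N₁ N₂ N₃ : Type u} [AddCommGroup N₁]
    [Module (IwasawaAlgebra p) N₁] [AddCommGroup N₂] [Module (IwasawaAlgebra p) N₂]
    [AddCommGroup N₃] [Module (IwasawaAlgebra p) N₃] [Module.Finite (IwasawaAlgebra p) N₂]
    (hN₂ : Module.IsTorsion (IwasawaAlgebra p) N₂)
    (f : N₁ →ₗ[IwasawaAlgebra p] N₂) (g : N₂ →ₗ[IwasawaAlgebra p] N₃)
    (hf : Function.Injective f) (hg : Function.Surjective g) (hfg : Function.Exact f g) :
    eulerExp p N₂ = eulerExp p N₁ + eulerExp p N₃ := by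
  haveI : Module.Finite (IwasawaAlgebra p) N₁ := Module.Finite.of_injective f hf
  haveI : Module.Finite (IwasawaAlgebra p) N₃ := Module.Finite.of_surjective g hg
  have hN₁ := isTorsion_of_injective f hf hN₂
  have hN₃ := isTorsion_of_surjective g hg hN₂
  unfold eulerExp
  rw [← finsum_mem_add_distrib' (finite_heightOneNeT_inter_support N₁ hN₁)
    (finite_heightOneNeT_inter_support N₃ hN₃)]
  refine finsum_mem_congr rfl fun 𝔮 h𝔮 ↦ ?_
  rw [Module.lengthAt_eq_add_of_exact f g hf hg hfg 𝔮,
    ENat.toNat_add (lengthAt_ne_top_of_isTorsion N₁ hN₁ 𝔮 (le_of_eq h𝔮.1))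
      (lengthAt_ne_top_of_isTorsion N₃ hN₃ 𝔮 (le_of_eq h𝔮.1)), add_mul]

/-- `e` is invariant under linear equivalences. [folklore] -/
theorem eulerExp_eq_of_linearEquiv {N N' : Type*} [AddCommGroup N] [Module (IwasawaAlgebra p) N]
    [AddCommGroup N'] [Module (IwasawaAlgebra p) N'] (e : N ≃ₗ[IwasawaAlgebra p] N') :
    eulerExp p N = eulerExp p N' := by
  unfold eulerExp
  exact finsum_mem_congr rfl fun 𝔮 _ ↦ by rw [Module.lengthAt_eq_of_linearEquiv e 𝔮]

/-- **`e(Λ/𝔮) = v_p(q_𝔮(0))`** for a height-one prime `𝔮 = (q_𝔮) ≠ (T)`. [folklore] -/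
theorem eulerExp_quotient_prime {𝔮 : PrimeSpectrum (IwasawaAlgebra p)} (h𝔮 : 𝔮 ∈ heightOneNeT p) :
    eulerExp p (IwasawaAlgebra p ⧸ 𝔮.asIdeal) = constVal p 𝔮 := by
  unfold eulerExp
  rw [finsum_mem_def]
  rw [finsum_eq_single _ 𝔮]
  · rw [Set.indicator_of_mem h𝔮, Module.lengthAt_quotient_self, ENat.toNat_one, one_mul]
  · intro 𝔮' hne
    by_cases h' : 𝔮' ∈ heightOneNeT p
    · rw [Set.indicator_of_mem h']
      have : Module.lengthAt (IwasawaAlgebra p) (IwasawaAlgebra p ⧸ 𝔮.asIdeal) 𝔮' = 0 := by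
        refine Module.lengthAt_quotient_eq_zero_of_not_le fun hle ↦ hne ?_
        exact (eq_of_height_eq_one_of_le h𝔮.1 h'.1 hle).symm
      rw [this, ENat.toNat_zero, zero_mul]
    · rw [Set.indicator_of_notMem h']

end EulerExp

/-! ### Counting in the six-term `ker`–`coker` sequence -/

section Counting

variable {R : Type*} [CommRing R]

/-- `#X = #ker φ · #range φ` for a linear map (Lagrange + first isomorphism theorem; `Nat.card`,
so also valid, vacuously, for infinite modules). [folklore] -/
theorem natCard_eq_card_ker_mul_card_range {X Y : Type*} [AddCommGroup X] [Module R X]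
    [AddCommGroup Y] [Module R Y] (φ : X →ₗ[R] Y) :
    Nat.card X = Nat.card (LinearMap.ker φ) * Nat.card (LinearMap.range φ) := by
  rw [Submodule.card_eq_card_quotient_mul_card (LinearMap.ker φ),
    Nat.card_congr φ.quotKerEquivRange.toEquiv]

/-- **Alternating product of orders in an exact sequence**
`0 → A₁ → A₂ → A₃ → B₁ → B₂ → B₃ → 0` with `A₁, A₃, B₁, B₃` finite: then `A₂, B₂` are finite and
`#B₂ · #A₁ · #A₃ = #A₂ · #B₁ · #B₃`. [folklore] -/
theorem card_of_exact_six {A₁ A₂ A₃ B₁ B₂ B₃ : Type*}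
    [AddCommGroup A₁] [Module R A₁] [AddCommGroup A₂] [Module R A₂] [AddCommGroup A₃] [Module R A₃]
    [AddCommGroup B₁] [Module R B₁] [AddCommGroup B₂] [Module R B₂] [AddCommGroup B₃] [Module R B₃]
    [Finite A₁] [Finite A₃] [Finite B₁] [Finite B₃]
    (a₁ : A₁ →ₗ[R] A₂) (a₂ : A₂ →ₗ[R] A₃) (δ : A₃ →ₗ[R] B₁) (b₁ : B₁ →ₗ[R] B₂) (b₂ : B₂ →ₗ[R] B₃)
    (ha₁ : Function.Injective a₁) (h₂ : Function.Exact a₁ a₂) (h₃ : Function.Exact a₂ δ)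
    (h₄ : Function.Exact δ b₁) (h₅ : Function.Exact b₁ b₂) (hb₂ : Function.Surjective b₂) :
    Finite A₂ ∧ Finite B₂ ∧
      Nat.card B₂ * Nat.card A₁ * Nat.card A₃ = Nat.card A₂ * Nat.card B₁ * Nat.card B₃ := by
  have e₂ := LinearMap.exact_iff.mp h₂   -- ker a₂ = range a₁
  have e₃ := LinearMap.exact_iff.mp h₃   -- ker δ = range a₂
  have e₄ := LinearMap.exact_iff.mp h₄   -- ker b₁ = range δ
  have e₅ := LinearMap.exact_iff.mp h₅   -- ker b₂ = range b₁
  have cA₂ := natCard_eq_card_ker_mul_card_range a₂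
  have cA₃ := natCard_eq_card_ker_mul_card_range δ
  have cB₁ := natCard_eq_card_ker_mul_card_range b₁
  have cB₂ := natCard_eq_card_ker_mul_card_range b₂
  rw [e₂] at cA₂
  rw [e₃] at cA₃
  rw [e₄] at cB₁
  rw [e₅, LinearMap.range_eq_top.mpr hb₂] at cB₂
  have hra₁ : Nat.card (LinearMap.range a₁) = Nat.card A₁ :=
    (Nat.card_congr (LinearEquiv.ofInjective a₁ ha₁).toEquiv).symm
  have htop : Nat.card (⊤ : Submodule R B₃) = Nat.card B₃ :=
    Nat.card_congr (Submodule.topEquiv (R := R) (M := B₃)).toEquiv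
  rw [hra₁] at cA₂
  rw [htop] at cB₂
  -- finiteness of the ranges involved
  haveI : Finite (LinearMap.range a₂) := Finite.of_injective _ Subtype.val_injective
  haveI : Finite (LinearMap.range δ) := Finite.of_injective _ Subtype.val_injective
  haveI : Finite (LinearMap.range b₁) := by
    refine Nat.finite_of_card_ne_zero ?_
    intro h0
    rw [h0, mul_zero] at cB₁
    exact Nat.card_pos.ne' cB₁
  have hA₂ : Finite A₂ := by
    refine Nat.finite_of_card_ne_zero ?_
    rw [cA₂]
    exact mul_ne_zero Nat.card_pos.ne' Nat.card_pos.ne'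
  have hB₂ : Finite B₂ := by
    refine Nat.finite_of_card_ne_zero ?_
    rw [cB₂]
    exact mul_ne_zero Nat.card_pos.ne' Nat.card_pos.ne'
  refine ⟨hA₂, hB₂, ?_⟩
  rw [cB₂, cA₂, cA₃, cB₁]
  ring

end Counting

/-! ### The snake: `0 → N₁[T] → N₂[T] → N₃[T] → N₁/T → N₂/T → N₃/T → 0` -/

section Snake

variable {p}
variable {N₁ N₂ N₃ : Type*} [AddCommGroup N₁] [Module (IwasawaAlgebra p) N₁]
  [AddCommGroup N₂] [Module (IwasawaAlgebra p) N₂] [AddCommGroup N₃] [Module (IwasawaAlgebra p) N₃]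
  (f : N₁ →ₗ[IwasawaAlgebra p] N₂) (g : N₂ →ₗ[IwasawaAlgebra p] N₃)
  (hf : Function.Injective f) (hg : Function.Surjective g) (hfg : Function.Exact f g)

/-- Multiplication by `T` as an endomorphism. [folklore] -/
abbrev mulX (N : Type*) [AddCommGroup N] [Module (IwasawaAlgebra p) N] : N →ₗ[IwasawaAlgebra p] N :=
  DistribSMul.toLinearMap (IwasawaAlgebra p) N (PowerSeries.X : IwasawaAlgebra p)

/-- Unfolding of `mulX`. [folklore] -/
theorem mulX_apply (N : Type*) [AddCommGroup N] [Module (IwasawaAlgebra p) N] (x : N) :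
    (mulX N : N →ₗ[IwasawaAlgebra p] N) x = (PowerSeries.X : IwasawaAlgebra p) • x := rfl

/-- The image of multiplication by `T` is `TM`. [folklore] -/
theorem range_mulX (N : Type*) [AddCommGroup N] [Module (IwasawaAlgebra p) N] :
    LinearMap.range (mulX N : N →ₗ[IwasawaAlgebra p] N) = TSubmodule p N := by
  ext y
  rw [LinearMap.mem_range, mem_TSubmodule_iff]
  exact Iff.rfl

/-- Exactness of `0 → N[T] → N →(T) N`. [folklore] -/
theorem exact_subtype_mulX (N : Type*) [AddCommGroup N] [Module (IwasawaAlgebra p) N] :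
    Function.Exact (invariants p N).subtype (mulX N : N →ₗ[IwasawaAlgebra p] N) :=
  LinearMap.exact_subtype_ker_map _

/-- Exactness of `N →(T) N → N/TN → 0`. [folklore] -/
theorem exact_mulX_mkQ (N : Type*) [AddCommGroup N] [Module (IwasawaAlgebra p) N] :
    Function.Exact (mulX N : N →ₗ[IwasawaAlgebra p] N) (TSubmodule p N).mkQ := by
  rw [LinearMap.exact_iff, Submodule.ker_mkQ, range_mulX]

/-- `f` restricted to `N₁[T] → N₂[T]`. [folklore] -/
def invariantsMap : invariants p N₁ →ₗ[IwasawaAlgebra p] invariants p N₂ :=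
  f.restrict fun x hx ↦ by
    rw [mem_invariants_iff] at hx ⊢
    rw [← map_smul, hx, map_zero]

/-- `f` induced on `N₁/T → N₂/T`. [folklore] -/
def coinvariantsMap : coinvariants p N₁ →ₗ[IwasawaAlgebra p] coinvariants p N₂ :=
  Submodule.mapQ _ _ f fun x hx ↦ by
    rw [Submodule.mem_comap]
    obtain ⟨y, rfl⟩ := (mem_TSubmodule_iff p N₁ x).mp hx
    rw [map_smul]
    exact X_smul_mem_TSubmodule p N₂ _

/-- Unfolding of `invariantsMap`. [folklore] -/
@[simp] theorem invariantsMap_apply (x : invariants p N₁) :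
    ((invariantsMap f x : invariants p N₂) : N₂) = f x := rfl

/-- Unfolding of `coinvariantsMap`. [folklore] -/
@[simp] theorem coinvariantsMap_mk (x : N₁) :
    coinvariantsMap f (Submodule.Quotient.mk x) = Submodule.Quotient.mk (f x) := rfl

include hf in
/-- `N₁[T] → N₂[T]` is injective if `N₁ → N₂` is. [folklore] -/
theorem invariantsMap_injective : Function.Injective (invariantsMap f) := by
  intro x y hxy
  apply Subtype.ext
  apply hf
  have := congrArg (fun z : invariants p N₂ ↦ (z : N₂)) hxy
  simpa using this

include hg in
/-- `N₂/T → N₃/T` is surjective if `N₂ → N₃` is. [folklore] -/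
theorem coinvariantsMap_surjective : Function.Surjective (coinvariantsMap g) := by
  intro q
  induction q using Submodule.Quotient.induction_on with
  | H y =>
    obtain ⟨x, rfl⟩ := hg y
    exact ⟨Submodule.Quotient.mk x, rfl⟩

include hf hfg in
/-- Exactness at `N₂[T]`. [folklore] -/
theorem exact_invariantsMap : Function.Exact (invariantsMap f) (invariantsMap g) := by
  intro x
  constructor
  · intro hx
    have hx' : g (x : N₂) = 0 := by
      have := congrArg (fun z : invariants p N₃ ↦ (z : N₃)) hx
      simpa using this
    obtain ⟨y, hy⟩ := (hfg (x : N₂)).mp hx'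
    have hyT : y ∈ invariants p N₁ := by
      rw [mem_invariants_iff]
      apply hf
      rw [map_smul, hy, map_zero]
      exact (mem_invariants_iff p N₂ _).mp x.2
    exact ⟨⟨y, hyT⟩, Subtype.ext (by simp [hy])⟩
  · rintro ⟨y, rfl⟩
    apply Subtype.ext
    show g (f y) = 0
    exact (hfg (f y)).mpr ⟨y, rfl⟩

include hg hfg in
/-- Exactness at `N₂/T`. [folklore] -/
theorem exact_coinvariantsMap : Function.Exact (coinvariantsMap f) (coinvariantsMap g) := by
  intro q
  constructor
  · intro hq
    induction q using Submodule.Quotient.induction_on with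
    | H x =>
      rw [coinvariantsMap_mk, Submodule.Quotient.mk_eq_zero, mem_TSubmodule_iff] at hq
      obtain ⟨z, hz⟩ := hq
      obtain ⟨w, rfl⟩ := hg z
      have h0 : g (x - (PowerSeries.X : IwasawaAlgebra p) • w) = 0 := by
        rw [map_sub, map_smul, hz, sub_self]
      obtain ⟨y, hy⟩ := (hfg _).mp h0
      refine ⟨Submodule.Quotient.mk y, ?_⟩
      rw [coinvariantsMap_mk, hy, Submodule.Quotient.mk_sub, sub_eq_self,
        Submodule.Quotient.mk_eq_zero]
      exact X_smul_mem_TSubmodule p N₂ w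
  · rintro ⟨q₁, rfl⟩
    induction q₁ using Submodule.Quotient.induction_on with
    | H y =>
      rw [coinvariantsMap_mk, coinvariantsMap_mk, (hfg (f y)).mpr ⟨y, rfl⟩,
        Submodule.Quotient.mk_zero]

/-- The connecting map `δ : N₃[T] → N₁/TN₁` of the snake lemma for multiplication by `T` on
`0 → N₁ → N₂ → N₃ → 0` (Mathlib's `SnakeLemma.δ'`). [folklore] -/
def snakeDelta : invariants p N₃ →ₗ[IwasawaAlgebra p] coinvariants p N₁ :=
  SnakeLemma.δ' (mulX N₁) (mulX N₂) (mulX N₃) f g hfg f g hfg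
    (by ext; simp) (by ext; simp)
    (invariants p N₃).subtype (exact_subtype_mulX N₃)
    (TSubmodule p N₁).mkQ (exact_mulX_mkQ N₁) hg hf

include hf hg hfg in
/-- Exactness at `N₃[T]`: `N₂[T] → N₃[T] →δ N₁/T` (snake lemma). [folklore] -/
theorem exact_invariantsMap_snakeDelta :
    Function.Exact (invariantsMap g) (snakeDelta f g hf hg hfg) :=
  SnakeLemma.exact_δ'_right (mulX N₁) (mulX N₂) (mulX N₃) f g hfg f g hfg
    (by ext; simp) (by ext; simp)
    (invariants p N₂).subtype (exact_subtype_mulX N₂)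
    (invariants p N₃).subtype (exact_subtype_mulX N₃)
    (TSubmodule p N₁).mkQ (exact_mulX_mkQ N₁) hg hf
    (invariantsMap g) (by ext; simp) (Submodule.subtype_injective _)

include hf hg hfg in
/-- Exactness at `N₁/T`: `N₃[T] →δ N₁/T → N₂/T` (snake lemma). [folklore] -/
theorem exact_snakeDelta_coinvariantsMap :
    Function.Exact (snakeDelta f g hf hg hfg) (coinvariantsMap f) :=
  SnakeLemma.exact_δ'_left (mulX N₁) (mulX N₂) (mulX N₃) f g hfg f g hfg
    (by ext; simp) (by ext; simp)
    (invariants p N₃).subtype (exact_subtype_mulX N₃)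
    (TSubmodule p N₁).mkQ (exact_mulX_mkQ N₁) (TSubmodule p N₂).mkQ (exact_mulX_mkQ N₂) hg hf
    (coinvariantsMap f) (by ext; simp) (Submodule.mkQ_surjective _)

include hf hg hfg in
/-- **Multiplicativity of the Herbrand quotient `#(N/TN)/#N[T]`** along `0 → N₁ → N₂ → N₃ → 0`
when the four outer groups are finite. [folklore] -/
theorem card_invariants_coinvariants_of_exact
    [Finite (invariants p N₁)] [Finite (invariants p N₃)]
    [Finite (coinvariants p N₁)] [Finite (coinvariants p N₃)] :
    Finite (invariants p N₂) ∧ Finite (coinvariants p N₂) ∧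
      Nat.card (coinvariants p N₂) * Nat.card (invariants p N₁) * Nat.card (invariants p N₃) =
        Nat.card (invariants p N₂) * Nat.card (coinvariants p N₁) * Nat.card (coinvariants p N₃) :=
  card_of_exact_six (invariantsMap f) (invariantsMap g) (snakeDelta f g hf hg hfg)
    (coinvariantsMap f) (coinvariantsMap g) (invariantsMap_injective f hf)
    (exact_invariantsMap f g hf hfg) (exact_invariantsMap_snakeDelta f g hf hg hfg)
    (exact_snakeDelta_coinvariantsMap f g hf hg hfg) (exact_coinvariantsMap f g hg hfg)
    (coinvariantsMap_surjective g hg)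

end Snake

/-! ### Transport of `N[T]`, `N/TN` along linear equivalences -/

section Transport

variable {p}
variable {N N' : Type*} [AddCommGroup N] [Module (IwasawaAlgebra p) N]
  [AddCommGroup N'] [Module (IwasawaAlgebra p) N'] (e : N ≃ₗ[IwasawaAlgebra p] N')

/-- `N[T] ≃ N'[T]` along `N ≃ N'`. [folklore] -/
def invariantsEquiv : invariants p N ≃ₗ[IwasawaAlgebra p] invariants p N' :=
  LinearEquiv.ofBijective (invariantsMap e.toLinearMap)
    ⟨invariantsMap_injective e.toLinearMap e.injective, fun y ↦ by
      refine ⟨⟨e.symm y, ?_⟩, ?_⟩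
      · rw [mem_invariants_iff, ← LinearEquiv.map_smul, (mem_invariants_iff p N' _).mp y.2,
          map_zero]
      · apply Subtype.ext
        simp⟩

/-- `N/TN ≃ N'/TN'` along `N ≃ N'`. [folklore] -/
def coinvariantsEquiv : coinvariants p N ≃ₗ[IwasawaAlgebra p] coinvariants p N' :=
  LinearEquiv.ofBijective (coinvariantsMap e.toLinearMap)
    ⟨by
      rw [← LinearMap.ker_eq_bot, eq_bot_iff]
      intro q hq
      induction q using Submodule.Quotient.induction_on with
      | H x =>
        rw [LinearMap.mem_ker, coinvariantsMap_mk, Submodule.Quotient.mk_eq_zero,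
          mem_TSubmodule_iff] at hq
        obtain ⟨z, hz⟩ := hq
        rw [Submodule.mem_bot, Submodule.Quotient.mk_eq_zero, mem_TSubmodule_iff]
        refine ⟨e.symm z, e.injective ?_⟩
        rw [LinearEquiv.map_smul, LinearEquiv.apply_symm_apply]
        exact hz,
      coinvariantsMap_surjective e.toLinearMap e.surjective⟩

end Transport

/-! ### The cyclic modules `Λ/𝔮` -/

section Cyclic

variable {p}

/-- If `T ∉ 𝔮` then `(Λ/𝔮)[T] = 0`. [folklore] -/
theorem invariants_quotient_eq_bot {𝔮 : PrimeSpectrum (IwasawaAlgebra p)}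
    (hX : (PowerSeries.X : IwasawaAlgebra p) ∉ 𝔮.asIdeal) :
    invariants p (IwasawaAlgebra p ⧸ 𝔮.asIdeal) = ⊥ := by
  rw [eq_bot_iff]
  intro y hy
  obtain ⟨a, rfl⟩ := Ideal.Quotient.mk_surjective y
  rw [mem_invariants_iff, Algebra.smul_def, Ideal.Quotient.algebraMap_eq, ← map_mul,
    Ideal.Quotient.eq_zero_iff_mem] at hy
  rw [Submodule.mem_bot, Ideal.Quotient.eq_zero_iff_mem]
  exact (𝔮.isPrime.mem_or_mem hy).resolve_left hX

/-- `T · (Λ/𝔮) = ((T) ⊔ 𝔮)/𝔮` as a submodule of `Λ/𝔮`. [folklore] -/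
theorem TSubmodule_quotient_eq_map (I : Ideal (IwasawaAlgebra p)) :
    TSubmodule p (IwasawaAlgebra p ⧸ I) =
      Submodule.map (Submodule.mkQ I) (Ideal.span {(PowerSeries.X : IwasawaAlgebra p)}) := by
  ext y
  rw [mem_TSubmodule_iff, Submodule.mem_map]
  constructor
  · rintro ⟨z, rfl⟩
    obtain ⟨a, rfl⟩ := Submodule.Quotient.mk_surjective I z
    exact ⟨PowerSeries.X * a, Ideal.mem_span_singleton'.mpr ⟨a, mul_comm _ _⟩, rfl⟩
  · rintro ⟨h, hh, rfl⟩
    obtain ⟨a, rfl⟩ := Ideal.mem_span_singleton'.mp hh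
    exact ⟨Submodule.Quotient.mk a, by rw [Submodule.mkQ_apply, mul_comm, ← smul_eq_mul,
      Submodule.Quotient.mk_smul]⟩

/-- `(Λ/I)/T ≃ Λ/(I + (T))`. [folklore] -/
def coinvariantsQuotientEquiv (I : Ideal (IwasawaAlgebra p)) :
    coinvariants p (IwasawaAlgebra p ⧸ I) ≃ₗ[IwasawaAlgebra p]
      IwasawaAlgebra p ⧸ (I ⊔ Ideal.span {(PowerSeries.X : IwasawaAlgebra p)}) :=
  (Submodule.quotEquivOfEq _ _ (TSubmodule_quotient_eq_map I)) ≪≫ₗ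
    Submodule.quotientQuotientEquivQuotientSup I (Ideal.span {(PowerSeries.X : IwasawaAlgebra p)})

/-- **`#Λ/(q, T) = p^{v_p(q(0))}`**: for `q(0) ≠ 0`, the kernel of the surjection
`Λ → ℤ_p → ℤ/p^{v_p(q(0))}` (constant term, then reduction) is `(q) + (T)`. [folklore] -/
theorem natCard_quotient_span_sup_span_X (q : IwasawaAlgebra p)
    (hq : PowerSeries.constantCoeff q ≠ 0) :
    Nat.card (IwasawaAlgebra p ⧸ (Ideal.span {q} ⊔ Ideal.span {(PowerSeries.X : IwasawaAlgebra p)})) =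
      p ^ (PowerSeries.constantCoeff q).valuation := by
  set v : ℕ := (PowerSeries.constantCoeff q).valuation with hv
  let ψ : IwasawaAlgebra p →+* ZMod (p ^ v) :=
    (PadicInt.toZModPow v).comp (PowerSeries.constantCoeff (R := ℤ_[p]))
  have hψ : Function.Surjective ψ := ZMod.ringHom_surjective ψ
  have hu := PadicInt.unitCoeff_spec hq
  set u := PadicInt.unitCoeff hq with hu'
  have hker : RingHom.ker ψ = Ideal.span {q} ⊔ Ideal.span {(PowerSeries.X : IwasawaAlgebra p)} := by
    apply le_antisymm
    · intro h hh
      rw [RingHom.mem_ker, RingHom.comp_apply, ← RingHom.mem_ker, PadicInt.ker_toZModPow,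
        Ideal.mem_span_singleton'] at hh
      obtain ⟨c, hc⟩ := hh
      -- `h = C(c u⁻¹) q + (h - C(c u⁻¹) q)`, the second summand in `(T)`
      have h0 : PowerSeries.constantCoeff (h - PowerSeries.C (c * ↑u⁻¹) * q) = 0 := by
        rw [map_sub, map_mul, PowerSeries.constantCoeff_C, ← hc, hu, sub_eq_zero]
        rw [mul_assoc, ← mul_assoc (↑u⁻¹ : ℤ_[p]), Units.inv_mul, one_mul]
      have hmem : h - PowerSeries.C (c * ↑u⁻¹) * q ∈
          Ideal.span {(PowerSeries.X : IwasawaAlgebra p)} := by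
        rw [mem_span_X_iff]
        exact h0
      have := Submodule.add_mem_sup (Ideal.mul_mem_left _ (PowerSeries.C (c * ↑u⁻¹))
        (Ideal.mem_span_singleton_self q)) hmem
      rwa [add_sub_cancel] at this
    · rw [sup_le_iff, Ideal.span_singleton_le_iff_mem, Ideal.span_singleton_le_iff_mem,
        RingHom.mem_ker, RingHom.mem_ker]
      constructor
      · rw [RingHom.comp_apply, ← RingHom.mem_ker, PadicInt.ker_toZModPow, hu]
        exact Ideal.mul_mem_left _ _ (Ideal.mem_span_singleton_self _)
      · rw [RingHom.comp_apply, PowerSeries.constantCoeff_X, map_zero]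
  rw [← hker, Nat.card_congr (RingHom.quotientKerEquivOfSurjective hψ).toEquiv, Nat.card_zmod]

/-- **The cyclic module `Λ/𝔮` for a height-one prime `𝔮 ≠ (T)`**: `(Λ/𝔮)[T] = 0`,
`#(Λ/𝔮)/T = p^{v_p(q_𝔮(0))}`. [folklore] -/
theorem card_quotient_prime {𝔮 : PrimeSpectrum (IwasawaAlgebra p)} (h𝔮 : 𝔮 ∈ heightOneNeT p) :
    invariants p (IwasawaAlgebra p ⧸ 𝔮.asIdeal) = ⊥ ∧
      Finite (coinvariants p (IwasawaAlgebra p ⧸ 𝔮.asIdeal)) ∧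
      Nat.card (coinvariants p (IwasawaAlgebra p ⧸ 𝔮.asIdeal)) = p ^ constVal p 𝔮 := by
  have hcard : Nat.card (coinvariants p (IwasawaAlgebra p ⧸ 𝔮.asIdeal)) = p ^ constVal p 𝔮 := by
    rw [Nat.card_congr (coinvariantsQuotientEquiv 𝔮.asIdeal).toEquiv]
    conv_lhs => rw [← span_primeGen h𝔮.1]
    exact natCard_quotient_span_sup_span_X _ (constantCoeff_primeGen_ne_zero h𝔮.1 h𝔮.2)
  refine ⟨invariants_quotient_eq_bot (X_notMem_of_ne_primeT h𝔮.1 h𝔮.2), ?_, hcard⟩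
  exact Nat.finite_of_card_ne_zero (by rw [hcard]; exact pow_ne_zero _ (Fact.out : p.Prime).ne_zero)

/-- A prime of `Λ` containing `T` other than `(T)` is the maximal ideal. [folklore] -/
theorem eq_maximalIdeal_of_X_mem {𝔮 : PrimeSpectrum (IwasawaAlgebra p)}
    (hX : (PowerSeries.X : IwasawaAlgebra p) ∈ 𝔮.asIdeal) (hne : 𝔮 ≠ primeT p) :
    𝔮.asIdeal = IsLocalRing.maximalIdeal (IwasawaAlgebra p) := by
  by_contra hmax
  have hle1 := height_le_one_of_ne_maximalIdeal p 𝔮.asIdeal hmax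
  have hlt : (primeT p).asIdeal < 𝔮.asIdeal := by
    refine lt_of_le_of_ne ?_ fun h ↦ hne (PrimeSpectrum.ext h).symm
    rw [primeT_asIdeal, Ideal.span_singleton_le_iff_mem]
    exact hX
  have h2 := Ideal.height_add_one_le_of_lt_of_isPrime hlt
  rw [height_primeT] at h2
  have : (1 : ℕ∞) + 1 ≤ 1 := h2.trans hle1
  exact absurd this (by decide)

end Cyclic

/-! ### The `Γ`-Euler characteristic formula for modules with `ℓ_{(T)} = 0` (dévissage) -/

section Devissage

variable {p}

/-- **`#(N/TN) = #N[T] · p^{e(N)}`** for a finitely generated torsion `Λ`-module `N` with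
`ℓ_{(T)}(N) = 0` (equivalently `N/TN` finite; the classical `Γ`-Euler characteristic formula
`#H¹/#H⁰ = |g(0)|_p^{-1}` for `char(N) = (g)`, `g(0) ≠ 0`: Greenberg, LNM 1716, proof of Thm. 4.1;
Perrin-Riou; Schneider). Proof by dévissage over a prime filtration of `N` (multiplicativity of
`#(·/T·)/#(·[T])` by the snake lemma, additivity of `e`, and the cyclic modules `Λ/𝔮`).
[cite: GreenbergLNM1716, §4 (Thm. 4.1 and Lemma 4.2)] -/
theorem card_coinvariants_of_lengthAt_eq_zero (N : Type u) [AddCommGroup N]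
    [Module (IwasawaAlgebra p) N] [hfin : Module.Finite (IwasawaAlgebra p) N]
    (hN : Module.IsTorsion (IwasawaAlgebra p) N)
    (h0 : Module.lengthAt (IwasawaAlgebra p) N (primeT p) = 0) :
    Finite (invariants p N) ∧ Finite (coinvariants p N) ∧
      Nat.card (coinvariants p N) = Nat.card (invariants p N) * p ^ eulerExp p N := by
  revert hN h0
  refine IsNoetherianRing.induction_on_isQuotientEquivQuotientPrime (A := IwasawaAlgebra p) hfin
    (motive := fun N _ _ _ ↦ Module.IsTorsion (IwasawaAlgebra p) N →
      Module.lengthAt (IwasawaAlgebra p) N (primeT p) = 0 →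
      Finite (invariants p N) ∧ Finite (coinvariants p N) ∧
        Nat.card (coinvariants p N) = Nat.card (invariants p N) * p ^ eulerExp p N) ?_ ?_ ?_
  · -- zero module
    intro N _ _ _ _ _ _
    refine ⟨inferInstance, Finite.of_surjective _ (Submodule.mkQ_surjective _), ?_⟩
    rw [eulerExp_eq_zero_of_finite, pow_zero, mul_one, Nat.card_unique, Nat.card_unique]
  · -- cyclic module `N ≃ Λ/𝔮`
    intro N _ _ _ 𝔮 e hN h0
    by_cases hX : (PowerSeries.X : IwasawaAlgebra p) ∈ 𝔮.asIdeal
    · -- `T ∈ 𝔮`: then `𝔮 ≠ (T)` (else `ℓ_{(T)} = 1`), so `𝔮 = 𝔪` and `N` is finite, killed by `T`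
      have hne : 𝔮 ≠ primeT p := by
        rintro rfl
        rw [Module.lengthAt_eq_of_linearEquiv e, Module.lengthAt_quotient_self] at h0
        exact one_ne_zero h0
      have hmax := eq_maximalIdeal_of_X_mem hX hne
      haveI : Finite N := by
        haveI := finite_quotient_maximalIdeal p
        rw [← hmax] at this
        exact Finite.of_equiv _ e.toEquiv.symm
      have hT : ∀ x : N, (PowerSeries.X : IwasawaAlgebra p) • x = 0 := fun x ↦ by
        apply e.injective
        obtain ⟨a, ha⟩ := Ideal.Quotient.mk_surjective (e x)
        rw [LinearEquiv.map_smul, map_zero, ← ha, Algebra.smul_def, Ideal.Quotient.algebraMap_eq,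
          ← map_mul, Ideal.Quotient.eq_zero_iff_mem]
        exact 𝔮.asIdeal.mul_mem_right _ hX
      have hinv : invariants p N = ⊤ := eq_top_iff.mpr fun x _ ↦ (mem_invariants_iff p N x).mpr (hT x)
      have hTsub : TSubmodule p N = ⊥ := by
        rw [eq_bot_iff]
        intro y hy
        obtain ⟨z, rfl⟩ := (mem_TSubmodule_iff p N y).mp hy
        rw [hT z]
        exact Submodule.zero_mem _
      refine ⟨inferInstance, Finite.of_surjective _ (Submodule.mkQ_surjective _), ?_⟩
      rw [eulerExp_eq_zero_of_finite, pow_zero, mul_one,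
        Nat.card_congr (Submodule.quotEquivOfEqBot _ hTsub).toEquiv, hinv,
        Nat.card_congr (Submodule.topEquiv (R := IwasawaAlgebra p) (M := N)).toEquiv]
    · -- `T ∉ 𝔮`: `𝔮 ≠ ⊥` (torsion), hence of height one, `N[T] = 0`, `#N/TN = p^{v(q(0))}`
      have hbot : 𝔮.asIdeal ≠ ⊥ := by
        intro hbot
        obtain ⟨a, ha⟩ := @hN (e.symm (Ideal.Quotient.mk 𝔮.asIdeal 1))
        have h1 : (a : IwasawaAlgebra p) • (Ideal.Quotient.mk 𝔮.asIdeal 1) = 0 := by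
          have := congrArg e ha
          rwa [Submonoid.smul_def, LinearEquiv.map_smul, LinearEquiv.apply_symm_apply,
            map_zero] at this
        rw [Algebra.smul_def, Ideal.Quotient.algebraMap_eq, ← map_mul, mul_one,
          Ideal.Quotient.eq_zero_iff_mem, hbot, Ideal.mem_bot] at h1
        exact nonZeroDivisors.coe_ne_zero a h1
      have hne𝔪 : 𝔮.asIdeal ≠ IsLocalRing.maximalIdeal (IwasawaAlgebra p) := fun h ↦
        hX (h ▸ (IsLocalRing.mem_maximalIdeal _).mpr (not_isUnit_X p))
      have hht : 𝔮.asIdeal.height = 1 := by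
        refine le_antisymm (height_le_one_of_ne_maximalIdeal p 𝔮.asIdeal hne𝔪) ?_
        rw [Order.one_le_iff_ne_zero, Ne, Ideal.height_eq_zero_iff_eq_bot]
        exact hbot
      have hneT : 𝔮 ≠ primeT p := by
        rintro rfl
        exact hX (by rw [primeT_asIdeal]; exact Ideal.mem_span_singleton_self _)
      have h𝔮 : 𝔮 ∈ heightOneNeT p := ⟨hht, hneT⟩
      obtain ⟨hinv, hfinC, hcard⟩ := card_quotient_prime h𝔮
      haveI := hfinC
      have hinvN : invariants p N = ⊥ := by
        rw [eq_bot_iff]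
        intro x hx
        have : invariantsEquiv e ⟨x, hx⟩ = 0 :=
          Subtype.ext ((Submodule.eq_bot_iff _).mp hinv _ (invariantsEquiv e ⟨x, hx⟩).2)
        rw [map_eq_zero_iff _ (invariantsEquiv e).injective] at this
        rw [Submodule.mem_bot]
        exact congrArg Subtype.val this
      refine ⟨?_, Finite.of_equiv _ (coinvariantsEquiv e).toEquiv.symm, ?_⟩
      · rw [hinvN]; infer_instance
      rw [Nat.card_congr (coinvariantsEquiv e).toEquiv, hcard, eulerExp_eq_of_linearEquiv e,
        eulerExp_quotient_prime h𝔮, hinvN, Nat.card_unique, one_mul]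
  · -- short exact sequences
    intro N₁ _ _ _ N₂ _ _ _ N₃ _ _ _ f g hf hg hfg ih₁ ih₃ hN₂ h0
    have hN₁ := isTorsion_of_injective f hf hN₂
    have hN₃ := isTorsion_of_surjective g hg hN₂
    have hadd := Module.lengthAt_eq_add_of_exact f g hf hg hfg (primeT p)
    rw [h0, eq_comm, add_eq_zero] at hadd
    obtain ⟨hfin₁, hfinC₁, hcard₁⟩ := ih₁ hN₁ hadd.1
    obtain ⟨hfin₃, hfinC₃, hcard₃⟩ := ih₃ hN₃ hadd.2
    obtain ⟨hfin₂, hfinC₂, hcard⟩ := card_invariants_coinvariants_of_exact f g hf hg hfg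
    refine ⟨hfin₂, hfinC₂, ?_⟩
    rw [eulerExp_eq_add_of_exact hN₂ f g hf hg hfg, pow_add]
    rw [hcard₁, hcard₃] at hcard
    have hpos : 0 < Nat.card (invariants p N₁) * Nat.card (invariants p N₃) :=
      Nat.mul_pos Nat.card_pos Nat.card_pos
    refine Nat.eq_of_mul_eq_mul_right hpos ?_
    calc Nat.card (coinvariants p N₂) * (Nat.card (invariants p N₁) * Nat.card (invariants p N₃))
        = Nat.card (coinvariants p N₂) * Nat.card (invariants p N₁) * Nat.card (invariants p N₃) := by
          ring
      _ = Nat.card (invariants p N₂) * (Nat.card (invariants p N₁) * p ^ eulerExp p N₁) *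
            (Nat.card (invariants p N₃) * p ^ eulerExp p N₃) := hcard
      _ = Nat.card (invariants p N₂) * (p ^ eulerExp p N₁ * p ^ eulerExp p N₃) *
            (Nat.card (invariants p N₁) * Nat.card (invariants p N₃)) := by ring

end Devissage

/-! ### The leading coefficient: `coeff_{ord f} f · #ker φ_M ∼ #coker φ_M` -/

section LeadingCoeff

/-- Products of nonzero `p`-adic integers: `∏ a_i^{k_i} = U · p^{∑ k_i v_p(a_i)}` with `U` a unit.
[folklore] -/
theorem exists_unit_mul_pow_eq_prod_pow {ι : Type*} [DecidableEq ι] (S : Finset ι)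
    (a : ι → ℤ_[p]) (k : ι → ℕ) (ha : ∀ i ∈ S, a i ≠ 0) :
    ∃ U : ℤ_[p]ˣ, ∏ i ∈ S, a i ^ k i = U * (p : ℤ_[p]) ^ (∑ i ∈ S, k i * (a i).valuation) := by
  induction S using Finset.induction_on with
  | empty => exact ⟨1, by simp⟩
  | insert i S hi ih =>
    obtain ⟨U, hU⟩ := ih fun j hj ↦ ha j (Finset.mem_insert_of_mem hj)
    have hai := ha i (Finset.mem_insert_self i S)
    refine ⟨PadicInt.unitCoeff hai ^ k i * U, ?_⟩
    rw [Finset.prod_insert hi, Finset.sum_insert hi, hU]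
    conv_lhs => rw [PadicInt.unitCoeff_spec hai]
    rw [Units.val_mul, Units.val_pow_eq_pow_val, pow_add, pow_mul, mul_pow]
    ring

variable (M : Type u) [AddCommGroup M] [Module (IwasawaAlgebra p) M]

/-- `ker φ_M ≃ (TM)[T]` (both are `M[T] ∩ TM`). [folklore] -/
def kerBocksteinEquiv :
    LinearMap.ker (bockstein p M) ≃ invariants p (TSubmodule p M) where
  toFun x := ⟨⟨((x : invariants p M) : M), (mem_ker_bockstein_iff p M _).mp x.2⟩,
    (mem_invariants_iff p _ _).mpr (Subtype.ext ((mem_invariants_iff p M _).mp (x : invariants p M).2))⟩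
  invFun y := ⟨⟨((y : TSubmodule p M) : M),
      (mem_invariants_iff p M _).mpr (congrArg Subtype.val ((mem_invariants_iff p _ _).mp y.2))⟩,
    (mem_ker_bockstein_iff p M _).mpr (y : TSubmodule p M).2⟩
  left_inv x := by ext; rfl
  right_inv y := by ext; rfl

/-- The surjection `M → TM/T²M`, `m ↦ T m`, with kernel `TM + M[T]`. [folklore] -/
def toCoinvariantsTSubmodule : M →ₗ[IwasawaAlgebra p] coinvariants p (TSubmodule p M) :=
  (TSubmodule p (TSubmodule p M)).mkQ ∘ₗ mulXOnto p M

/-- `m ↦ T m mod T²M` is onto. [folklore] -/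
theorem toCoinvariantsTSubmodule_surjective :
    Function.Surjective (toCoinvariantsTSubmodule p M) :=
  (Submodule.mkQ_surjective _).comp (mulXOnto_surjective p M)

/-- The kernel of `M → TM/T²M`, `m ↦ Tm`, is `TM + M[T]`. [folklore] -/
theorem ker_toCoinvariantsTSubmodule :
    LinearMap.ker (toCoinvariantsTSubmodule p M) = TSubmodule p M ⊔ invariants p M := by
  ext m
  rw [LinearMap.mem_ker, toCoinvariantsTSubmodule, LinearMap.comp_apply, Submodule.mkQ_apply,
    Submodule.Quotient.mk_eq_zero, mem_TSubmodule_iff, Submodule.mem_sup]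
  constructor
  · rintro ⟨n, hn⟩
    have hn' : (PowerSeries.X : IwasawaAlgebra p) • (n : M) = (PowerSeries.X : IwasawaAlgebra p) • m := by
      have := congrArg Subtype.val hn
      rwa [Submodule.coe_smul, mulXOnto_apply] at this
    refine ⟨(n : M), n.2, m - n, ?_, add_sub_cancel _ _⟩
    rw [mem_invariants_iff, smul_sub, hn', sub_self]
  · rintro ⟨y, hy, z, hz, rfl⟩
    refine ⟨⟨y, hy⟩, Subtype.ext ?_⟩
    rw [Submodule.coe_smul, mulXOnto_apply, smul_add, (mem_invariants_iff p M z).mp hz, add_zero]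

/-- **`coker φ_M ≃ TM/T(TM)`**: `coker φ_M = (M/TM)/im M[T] ≃ M/(TM + M[T]) ≃ TM/T²M` via
`m ↦ Tm`. [folklore] -/
def cokerBocksteinEquiv :
    (coinvariants p M ⧸ LinearMap.range (bockstein p M)) ≃ₗ[IwasawaAlgebra p]
      coinvariants p (TSubmodule p M) :=
  (Submodule.quotEquivOfEq _ _ (by
      rw [bockstein, LinearMap.range_comp, Submodule.range_subtype])) ≪≫ₗ
    Submodule.quotientQuotientEquivQuotientSup (TSubmodule p M) (invariants p M) ≪≫ₗ
    (Submodule.quotEquivOfEq _ _ (ker_toCoinvariantsTSubmodule p M).symm) ≪≫ₗ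
    (toCoinvariantsTSubmodule p M).quotKerEquivOfSurjective (toCoinvariantsTSubmodule_surjective p M)

variable [Module.Finite (IwasawaAlgebra p) M] (hM : Module.IsTorsion (IwasawaAlgebra p) M)
include hM

/-- `e(M/TM) = 0` and hence `e(TM) = e(M)` for `M` finitely generated torsion. [folklore] -/
theorem eulerExp_TSubmodule : eulerExp p (TSubmodule p M) = eulerExp p M := by
  have h := eulerExp_eq_add_of_exact hM (TSubmodule p M).subtype (TSubmodule p M).mkQ
    (Submodule.subtype_injective _) (Submodule.mkQ_surjective _) (LinearMap.exact_subtype_mkQ _)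
  rw [h, eulerExp_eq_zero_of_forall (coinvariants p M), add_zero]
  intro 𝔮 h𝔮
  exact Module.lengthAt_eq_zero_of_isTorsionBy (fun q ↦ X_smul_coinvariants p M q) 𝔮
    (X_notMem_of_ne_primeT h𝔮.1 h𝔮.2)

/-- **`p^{e(M)}` is the leading coefficient of `f` up to a `p`-adic unit**: if `char(M) = (f)` then
`coeff_{ℓ_{(T)}(M)} f = U · p^{e(M)}` for a unit `U ∈ ℤ_p^×` (and `ℓ_{(T)}(M) = ord_T f`,
`order_eq_toNat_lengthAt`). [cite: Washington1997, §13.2] -/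
theorem coeff_lengthAt_charGenerator_eq_unit_mul_pow (f : IwasawaAlgebra p)
    (hf : Module.charIdeal (IwasawaAlgebra p) M = Ideal.span {f}) :
    ∃ U : ℤ_[p]ˣ, PowerSeries.coeff (Module.lengthAt (IwasawaAlgebra p) M (primeT p)).toNat f =
      U * (p : ℤ_[p]) ^ eulerExp p M := by
  classical
  obtain ⟨S, u, hS, hout, hfact⟩ := exists_charGenerator_eq_unit_mul p M hM f hf
  have hgen0 : ∀ 𝔮 ∈ S, PowerSeries.constantCoeff (primeGen p 𝔮) ≠ 0 := fun 𝔮 h𝔮 ↦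
    constantCoeff_primeGen_ne_zero (hS 𝔮 h𝔮).1 (hS 𝔮 h𝔮).2
  obtain ⟨U, hU⟩ := exists_unit_mul_pow_eq_prod_pow p S
    (fun 𝔮 ↦ PowerSeries.constantCoeff (primeGen p 𝔮))
    (fun 𝔮 ↦ (Module.lengthAt (IwasawaAlgebra p) M 𝔮).toNat) hgen0
  -- the exponent is `e(M)`
  have hsum : ∑ 𝔮 ∈ S, (Module.lengthAt (IwasawaAlgebra p) M 𝔮).toNat *
      (PowerSeries.constantCoeff (primeGen p 𝔮)).valuation = eulerExp p M := by
    unfold eulerExp constVal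
    refine (finsum_mem_eq_sum_of_subset _ ?_ ?_).symm
    · rintro 𝔮 ⟨h𝔮, hsupp⟩
      by_contra hnot
      refine hsupp (show (Module.lengthAt (IwasawaAlgebra p) M 𝔮).toNat *
        (PowerSeries.constantCoeff (primeGen p 𝔮)).valuation = 0 from ?_)
      rw [hout 𝔮 h𝔮.1 h𝔮.2 (fun h ↦ hnot (Finset.mem_coe.mpr h)), ENat.toNat_zero, zero_mul]
    · intro 𝔮 h𝔮
      exact hS 𝔮 (Finset.mem_coe.mp h𝔮)
  -- the constant term of the unit `u`
  have hu0 : IsUnit (PowerSeries.constantCoeff (u : IwasawaAlgebra p)) :=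
    PowerSeries.isUnit_iff_constantCoeff.mp u.isUnit
  refine ⟨hu0.unit * U, ?_⟩
  rw [hfact, coeff_unit_mul_X_pow_mul, map_prod]
  simp only [map_pow]
  rw [hU, hsum, Units.val_mul, IsUnit.unit_spec, mul_assoc]

/-- **The `Γ`-Euler characteristic formula for the leading coefficient.** Let `M` be a finitely
generated torsion `Λ`-module with `char(M) = (f)` and suppose `ker φ_M` is finite (equivalently
`coker φ_M` finite, equivalently `ord_T f = rank_{ℤ_p} M/TM`). Then
`coeff_{ord_T f}(f) · #ker φ_M = u · #coker φ_M` for a unit `u ∈ ℤ_p^×`, i.e. the leading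
coefficient of `f` has the same valuation as `#coker φ_M / #ker φ_M` (the truncated `Γ`-Euler
characteristic of the dual discrete module: CSS (2003) §3 (31) and p. 204; Ray–Sujatha (2020)
Lemma 2.4 after Zerbes (2009); for `ord_T f = 0` Greenberg, LNM 1716, §4 Thm. 4.1 / Lemma 4.2).
Proof: with `N = TM`, `ker φ_M ≃ N[T]`, `coker φ_M ≃ N/TN`, `ℓ_{(T)}(N) = 0`, so by dévissage
`#(N/TN) = #N[T] · p^{e(N)}`, `e(N) = e(M)`, and `coeff_{ord f} f = U p^{e(M)}`.
[cite: CoatesSchneiderSujatha2003, §3 (31) and p. 204] [cite: GreenbergLNM1716, §4 Thm. 4.1] -/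
theorem coeff_order_charGenerator_mul_card_ker_bockstein (f : IwasawaAlgebra p)
    (hf : Module.charIdeal (IwasawaAlgebra p) M = Ideal.span {f})
    (hfin : Finite (LinearMap.ker (bockstein p M))) :
    ∃ u : ℤ_[p]ˣ,
      PowerSeries.coeff f.order.toNat f * (Nat.card (LinearMap.ker (bockstein p M)) : ℤ_[p]) =
        u * Nat.card (coinvariants p M ⧸ LinearMap.range (bockstein p M)) := by
  -- `N = TM`
  haveI : Module.Finite (IwasawaAlgebra p) (TSubmodule p M) :=
    Module.Finite.of_injective _ (Submodule.subtype_injective _)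
  have hN : Module.IsTorsion (IwasawaAlgebra p) (TSubmodule p M) :=
    isTorsion_of_injective _ (Submodule.subtype_injective _) hM
  have hℓN : Module.lengthAt (IwasawaAlgebra p) (TSubmodule p M) (primeT p) = 0 := by
    rw [lengthAt_TSubmodule_eq_zero_iff p M hM]
    exact (finite_iff_lengthAt_eq_zero_of_X_smul_eq_zero p (LinearMap.ker (bockstein p M))
      (fun x ↦ Subtype.ext (X_smul_invariants p M (x : invariants p M)))).mp hfin
  obtain ⟨-, -, hcard⟩ := card_coinvariants_of_lengthAt_eq_zero (TSubmodule p M) hN hℓN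
  rw [eulerExp_TSubmodule p M hM, ← Nat.card_congr (kerBocksteinEquiv p M),
    ← Nat.card_congr (cokerBocksteinEquiv p M).toEquiv] at hcard
  obtain ⟨U, hU⟩ := coeff_lengthAt_charGenerator_eq_unit_mul_pow p M hM f hf
  have hord : f.order.toNat = (Module.lengthAt (IwasawaAlgebra p) M (primeT p)).toNat := by
    rw [order_eq_toNat_lengthAt p hM f hf (primeT p) (primeT_asIdeal p), ENat.toNat_coe]
  refine ⟨U, ?_⟩
  rw [hord, hU, hcard]
  push_cast
  ring

/-- The same with the order of vanishing named: if `ord_T f = n` then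
`coeff_n f · #ker φ_M = u · #coker φ_M`. [cite: CoatesSchneiderSujatha2003, §3 (31) and p. 204] -/
theorem coeff_charGenerator_mul_card_ker_bockstein_of_order_eq (f : IwasawaAlgebra p)
    (hf : Module.charIdeal (IwasawaAlgebra p) M = Ideal.span {f}) {n : ℕ} (hn : f.order = n)
    (hfin : Finite (LinearMap.ker (bockstein p M))) :
    ∃ u : ℤ_[p]ˣ,
      PowerSeries.coeff n f * (Nat.card (LinearMap.ker (bockstein p M)) : ℤ_[p]) =
        u * Nat.card (coinvariants p M ⧸ LinearMap.range (bockstein p M)) := by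
  have h := coeff_order_charGenerator_mul_card_ker_bockstein p M hM f hf hfin
  rwa [hn, ENat.toNat_coe] at h

end LeadingCoeff

end Literature.NumberTheory.EllipticCurves.IwasawaAlgebra

end
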